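import Literature.MathematicalPhysics.QuantumLattice.HubbardTTPrimeThermalWindowCertificateSymm
import Literature.MathematicalPhysics.QuantumLattice.BoxDualCovarianceCombination
import HarnessLib

/-!
# Single-anchor transport of a THERMAL (`T > 0`, EEB-class) `t–t'` window certificate to ANY point of
# the `(t', U)` half-plane: the exact identity with eom AND energy–entropy-balance charges, its soundness
# in every thermal torus limit at the target, and the priced / kinematic (Lipschitz) / `U`-ray forms

Family `hubbard` (topic `MathematicalPhysics/QuantumLattice`); the positive-temperature companion of
`HubbardTTPrimeWindowCertificateAnchorTransport` (`T = 0`, seat unc-1 of the material-oracle cell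
`pub/hubbard-downfold`: «a downfolded parameter BOX in `(t'/t, U/t)` must inherit the certified words of the
nearest anchor», here for the `T` axis of the phase map, D-0096 «T > 0»). The object is the THERMAL window
certificate of `HubbardTTPrimeThermalWindowCertificateSymm` (Fawzi–Fawzi–Scalet's EEB-constrained state
relaxation read through its rounded dual: Gram part, eom rows, affine-`D₄` / translation / spin-flip defects,
charged words, generic nulls, linearised ENERGY–ENTROPY-BALANCE rows `λᵣ·EEB_{β,sᵣ,qᵣ}(Aᵣ)`, extra rows
`κₑ Gₑ` such as the matrix cuts of `TorusGibbsMatrixCuts`, anti-Hermitian parts, residual words) and the state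
class is the tree's thermal object: torus limits of the canonical `(rectN n L, S^z = 0)`-sector Gibbs states of
`hubbardTorusTT' L t t' U` at inverse temperature `β` (`TorusSectorGibbsMixture`).

The `t–t'–U` interaction is affine in the couplings,
`Φ(t,t'_A,U_A) = Φ(t,t'_P,U_P) + (t'_A − t'_P) Φ(0,1,0) + (U_A − U_P) Φ(0,0,1)`
(`hubbardTTPrimeFermionInteraction_taylor`), hence so are the local Hamiltonians, the mean-energy observable,
the eom rows AND the commutator part `β (ΓA)ᴴ(H_{Λ'}ΓA − ΓA H_{Λ'})` of every EEB row (its `−s (ΓA)ᴴΓA + q ΓA(ΓA)ᴴ`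
part is coupling-free) and of every matrix-cut row. So a thermal identity issued at the anchor `A` IS a
thermal identity at ANY target `P` with the same Gram/null/EEB data, objective
`Xw + (t'_A − t'_P)(κ ΓE_{Φ(0,1,0)} − W_{t'} − V_{t'} − X_{t'}) + (U_A − U_P)(κ ΓE_{Φ(0,0,1)} − W_U − V_U − X_U)`
and the same constant and cap (`thermalCertificate_TT'_transport`, §1), where besides the eom charges
`W = Σₖ (H_{Λ'}(·) ΓBₖ − ΓBₖ H_{Λ'}(·))` of the `T = 0` theory two new conjugate operators appear: the
**EEB charges** `V = β Σᵣ λᵣ (ΓAᵣ)ᴴ(H_{Λ'}(·) ΓAᵣ − ΓAᵣ H_{Λ'}(·))` and the extra-row charges `X = Σₑ κₑ G^{T/D}_ₑ`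
of any coupling-affine extra rows `Gₑ = G^P_ₑ + (t'_A − t'_P) G^T_ₑ + (U_A − U_P) G^D_ₑ` (§0 gives the split
for the matrix-cut rows, `matrixCutRow_of_add_smul_smul`; coupling-free rows take `G^T = G^D = 0`). One
application of the tree's reader `IsTorusLimitOfMixture.re_expect_ge_of_thermal_certificate_symm_TT'_of_sectorGibbs`
AT THE TARGET — where stationarity, the EEB inequalities, all symmetry nulls and the densities of the
TARGET Gibbs states are discharged — gives (§2), for every thermal torus limit `ω` at `(β, t, t'_P, U_P, n)`:

  `c − Σₖ‖aₖ‖ + (Σ_σ μ_σ)(n/2 − ν) + κ (u − e^{t t'_P U_P}(ω)) − κ[(t'_A − t'_P) K₂(ω) + (U_A − U_P) D(ω)]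
     + (t'_A − t'_P) Re ω(W_{t'} + V_{t'} + X_{t'}) + (U_A − U_P) Re ω(W_U + V_U + X_U) ≤ Re ω_{Λ'}(Xw)`,

`K₂(ω) = e_{Φ(0,1,0)}(ω)`, `D(ω) = e_{Φ(0,0,1)}(ω) = Re ω(n_{0↑}n_{0↓})` — the thermal expectations of the two
conjugate words. §3 prices the conjugate terms by a target cap `e^{t t'_P U_P}(ω) ≤ u'`, certified brackets
`K₂(ω) ∈ [τlo, τhi]`, `D(ω) ∈ [dlo, dhi]` (the kinematic rows of `TorusSectorGibbsMixture` §4, or the BOX words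
of `HubbardTTPrimeDoccTransportThermal` §3 / `HubbardTTPrimeDiagHopTransportThermal`) and the operator norms of
the total charges (`…_transport_priced`); §4 is the a-priori LIPSCHITZ form for the thermal object
(`|K₂| ≤ 16/π²`, `0 ≤ D ≤ n/2`, entropy cap `e + 2H_b(n/2)/β`): the anchor's certified thermal word degrades by
`|t'_A − t'_P|·(16κ/π² + ‖W_{t'} + V_{t'} + X_{t'}‖) + |U_A − U_P|·(κ n/2 + ‖W_U + V_U + X_U‖)` plus the cap
re-booking (`…_transport_kinematic`); §5 is the `U`-ray `t'_A = t'_P` (`…_transport_U_priced`,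
`…_transport_U_kinematic`) — the `T > 0` twin of `HubbardTTPrimeUBoxWords` §4. Relation to the CAP-CLASS
thermal transport of `HubbardTTPrimeDoccTransportThermal` §4 (one anchor cap-class certificate words a
`(t'-box) × (U-box) × (T ≤ T₀)` cell): that moves certificates whose only state hypothesis is an energy cap;
here the certificate carries stationarity and EEB rows of the ANCHOR Hamiltonian, which a target Gibbs state
violates by exactly the displayed conjugate terms. Thermal words do not move in `β` (same `β` at `A` and `P`).

HONEST SCOPE: transport lemmas only — no number, no new certificate, no claim on the Hubbard model's phases;
the charged-generator caveat of the reader (EEB generators must conserve the local `N` and `S^z`) and the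
torus-limit thermal convention are unchanged; the extra rows' target parts `G^P_ₑ` stay hypotheses BY NAME
(for matrix cuts: `IsTorusLimitOfMixture.re_expect_matrixCut_nonneg_of_sectorGibbs_of_thicken_subset` at
the target couplings). WHAT THIS IS NOT: a certificate, a phase sentence, or a `T_c` statement.
Everything is PROVED; no definition, no named fact, no numerical input.

## Mathlib / tree search

REUSED: `hubbardTTPrimeFermionInteraction_taylor`, `FermionInteraction.localHamiltonian_of_add_smul_smul`,
`FermionInteraction.meanEnergyObs_of_add_smul_smul`, `commutator_add_smul_smul_expand`
(`BoxDualCovarianceCombination` §1), `InfVolFermionState.IsTorusLimitOfMixture.re_expect_ge_of_thermal_certificate_symm_TT'_of_sectorGibbs`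
(`HubbardTTPrimeThermalWindowCertificateSymm`), `IsTorusLimitOfMixture.abs_meanEnergy_diagHop_le_of_sectorGibbs`,
`….docc_mem_Icc_of_sectorGibbs`, `….meanEnergy_hubbardTTPrime_le_energyDensityTT'_add_binEntropy_div`
(`TorusSectorGibbsMixture` §4–§5), `InfVolFermionState.abs_re_expect_le`; Mathlib `module`, `abel`, `linarith`.
`lean search 'thermal_certificate.*transport|eebRows|transport_identity_of_affine'`: nothing — the only
coupling-transport theorems for thermal states in the tree are the cap-class / conjugate-word rows of
`HubbardTTPrimeDiagHopTransportThermal`, `HubbardTTPrimeDoccTransportThermal`. presearch (corpus hybrid +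
galaxy, «EEB relaxation different couplings / dual certificate perturbation of the Hamiltonian»): none beyond the
sources below; the transport is the folklore sensitivity of a dual certificate to affine data, written out.

## References

* H. Fawzi, O. Fawzi, S. O. Scalet (2024), §3.2–3.3, Thm. 3.6 (EEB-constrained relaxations bound thermal
  expectation values; matrix EEB). [cite: FawziFawziScalet2024, Thm. 3.6]
* J. Wang et al., PRX 14 (2024) 031006, §III (constrained relaxations; conjugate observables of linear
  couplings enter the dual linearly). [cite: WangEtAl2024, §III]
* T. Koma, H. Tasaki, J. Stat. Phys. 76 (1994) 745, §1 (conjugate observables of linear couplings).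
  [cite: KomaTasaki1994, §1]
* E. H. Lieb, M. Loss, Duke Math. J. 71 (1993) 337, §8 Thm. 8.2 (bathtub: the kinematic hopping range).
  [cite: LiebLoss1993, §8, Theorem 8.2]
* D. Ruelle, *Statistical Mechanics: Rigorous Results* (1969), §3.4. [cite: Ruelle1969, §3.4]
* O. Bratteli, D. W. Robinson, *Operator Algebras and QSM 1* (1987), Prop. 2.3.11 (`|ω(A)| ≤ ‖A‖`).
  [cite: BratteliRobinsonI1987, Prop. 2.3.11]
-/

noncomputable section

namespace Literature.MathematicalPhysics.QuantumLattice

open Matrix Finset HubbardWave0 Literature.Probability.LatticeModels ThermodynamicLimit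
open Literature.MathematicalPhysics.QuantumManyBody.StateRelaxation
open _root_.Filter
open scoped _root_.Topology ComplexOrder BigOperators

/-! ### §0 Affine bookkeeping: the coupling-dependent rows of a thermal certificate split at the target -/

/-- **Abstract transport identity.** If the energy observable, the eom block, the EEB block and the
extra-row block of a window identity are affine in two parameters with the SAME coefficients `a, b`
(`E_A = E_P + a E_T + b E_D`, …), then the identity at the anchor (objective `Xw`, constant `c`, cap `u`,
multiplier `κ`) is an identity at the target with objective
`Xw + a (κ E_T − N_T − B_T − X_T) + b (κ E_D − N_D − B_D − X_D)` and the same `c, u, κ`. [folklore]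
[cite: WangEtAl2024, §III] -/
theorem transport_identity_of_affine_rows {Λ' : Finset (Site 2)}
    (Xw M G SY R EA EP ET ED NA NP NT ND BA BP BT BD XA XP XT XD : FermionOp Λ') (c u κ : ℝ) (a b : ℂ)
    (hE : EA = EP + a • ET + b • ED) (hN : NA = NP + a • NT + b • ND) (hB : BA = BP + a • BT + b • BD)
    (hX : XA = XP + a • XT + b • XD)
    (hcert : Xw - (c : ℂ) • (1 : FermionOp Λ') - M - ((κ : ℝ) : ℂ) • (((u : ℝ) : ℂ) • (1 : FermionOp Λ') - EA) =
      G + (NA + SY) + (BA + XA) + R) :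
    (Xw + a • (((κ : ℝ) : ℂ) • ET - NT - BT - XT) + b • (((κ : ℝ) : ℂ) • ED - ND - BD - XD)) -
        (c : ℂ) • (1 : FermionOp Λ') - M - ((κ : ℝ) : ℂ) • (((u : ℝ) : ℂ) • (1 : FermionOp Λ') - EP) =
      G + (NP + SY) + (BP + XP) + R := by
  subst hE hN hB hX
  have key : (Xw + a • (((κ : ℝ) : ℂ) • ET - NT - BT - XT) + b • (((κ : ℝ) : ℂ) • ED - ND - BD - XD)) -
        (c : ℂ) • (1 : FermionOp Λ') - M - ((κ : ℝ) : ℂ) • (((u : ℝ) : ℂ) • (1 : FermionOp Λ') - EP) =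
      (Xw - (c : ℂ) • (1 : FermionOp Λ') - M -
          ((κ : ℝ) : ℂ) • (((u : ℝ) : ℂ) • (1 : FermionOp Λ') - (EP + a • ET + b • ED))) -
        a • (NT + BT + XT) - b • (ND + BD + XD) := by
    module
  rw [key, hcert]
  module

/-- The eom block of a certificate whose Hamiltonian is `H = H_P + a H_T + b H_D` splits accordingly
(`W_T = Σₖ (H_T ΓBₖ − ΓBₖ H_T)`, `W_D` likewise are the «coupling charges» of the eom rows).
[cite: KomaTasaki1994, §1] -/
theorem eomRows_of_add_smul_smul {Λ Λ' : Finset (Site 2)} (hΛ : Λ ⊆ Λ') {H HP HT HD : FermionOp Λ'}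
    {a b : ℂ} (hH : H = HP + a • HT + b • HD) {κ' : Type*} (s : Finset κ') (B : κ' → FermionOp Λ) :
    ∑ k ∈ s, (H * fermionEmbed (PolySite.incl hΛ) (B k) - fermionEmbed (PolySite.incl hΛ) (B k) * H) =
      ∑ k ∈ s, (HP * fermionEmbed (PolySite.incl hΛ) (B k) - fermionEmbed (PolySite.incl hΛ) (B k) * HP) +
        a • ∑ k ∈ s, (HT * fermionEmbed (PolySite.incl hΛ) (B k) - fermionEmbed (PolySite.incl hΛ) (B k) * HT) +
        b • ∑ k ∈ s, (HD * fermionEmbed (PolySite.incl hΛ) (B k) - fermionEmbed (PolySite.incl hΛ) (B k) * HD) := by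
  rw [Finset.smul_sum, Finset.smul_sum, ← Finset.sum_add_distrib, ← Finset.sum_add_distrib]
  refine Finset.sum_congr rfl fun k _ => ?_
  rw [hH]
  exact commutator_add_smul_smul_expand HP HT HD _ a b

/-- The linearised energy–entropy-balance block of a thermal certificate whose Hamiltonian is
`H = H_P + a H_T + b H_D` splits accordingly: only the commutator part `β (ΓA)ᴴ(HΓA − ΓA H)` depends on
`H`, and `V_T = β Σᵣ λᵣ (ΓAᵣ)ᴴ(H_T ΓAᵣ − ΓAᵣ H_T)` (`V_D` likewise) are the «EEB charges».
[cite: FawziFawziScalet2024, §3.2] -/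
theorem eebRows_of_add_smul_smul {Λ Λ' : Finset (Site 2)} (hΛ : Λ ⊆ Λ') {H HP HT HD : FermionOp Λ'}
    {a b : ℂ} (hH : H = HP + a • HT + b • HD) {θ : Type*} (rr : Finset θ) (lam : θ → ℝ)
    (A : θ → FermionOp Λ) (β : ℝ) (sv qv : θ → ℝ) :
    ∑ r ∈ rr, ((lam r : ℝ) : ℂ) •
        (((β : ℝ) : ℂ) • ((fermionEmbed (PolySite.incl hΛ) (A r))ᴴ *
            (H * fermionEmbed (PolySite.incl hΛ) (A r) - fermionEmbed (PolySite.incl hΛ) (A r) * H)) -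
          ((sv r : ℝ) : ℂ) • ((fermionEmbed (PolySite.incl hΛ) (A r))ᴴ * fermionEmbed (PolySite.incl hΛ) (A r)) +
          ((qv r : ℝ) : ℂ) • (fermionEmbed (PolySite.incl hΛ) (A r) * (fermionEmbed (PolySite.incl hΛ) (A r))ᴴ)) =
      ∑ r ∈ rr, ((lam r : ℝ) : ℂ) •
          (((β : ℝ) : ℂ) • ((fermionEmbed (PolySite.incl hΛ) (A r))ᴴ *
              (HP * fermionEmbed (PolySite.incl hΛ) (A r) - fermionEmbed (PolySite.incl hΛ) (A r) * HP)) -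
            ((sv r : ℝ) : ℂ) • ((fermionEmbed (PolySite.incl hΛ) (A r))ᴴ * fermionEmbed (PolySite.incl hΛ) (A r)) +
            ((qv r : ℝ) : ℂ) • (fermionEmbed (PolySite.incl hΛ) (A r) * (fermionEmbed (PolySite.incl hΛ) (A r))ᴴ)) +
        a • ∑ r ∈ rr, ((lam r : ℝ) : ℂ) • (((β : ℝ) : ℂ) • ((fermionEmbed (PolySite.incl hΛ) (A r))ᴴ *
            (HT * fermionEmbed (PolySite.incl hΛ) (A r) - fermionEmbed (PolySite.incl hΛ) (A r) * HT))) +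
        b • ∑ r ∈ rr, ((lam r : ℝ) : ℂ) • (((β : ℝ) : ℂ) • ((fermionEmbed (PolySite.incl hΛ) (A r))ᴴ *
            (HD * fermionEmbed (PolySite.incl hΛ) (A r) - fermionEmbed (PolySite.incl hΛ) (A r) * HD))) := by
  rw [Finset.smul_sum, Finset.smul_sum, ← Finset.sum_add_distrib, ← Finset.sum_add_distrib]
  refine Finset.sum_congr rfl fun r _ => ?_
  rw [hH, commutator_add_smul_smul_expand HP HT HD _ a b, mul_add, mul_add, mul_smul_comm, mul_smul_comm]
  module

/-- Extra rows given with an affine split `Gₑ = G^P_ₑ + a G^T_ₑ + b G^D_ₑ` (e.g. the matrix-cut «eeb-mat»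
rows, whose commutator part is affine in the Hamiltonian; coupling-free rows take `G^T = G^D = 0`)
split blockwise. [folklore] [cite: FawziFawziScalet2024, §3.3] -/
theorem extraRows_of_split {Λ' : Finset (Site 2)} {a b : ℂ} {η : Type*} (gg : Finset η) (kap : η → ℝ)
    (G GP GT GD : η → FermionOp Λ') (hG : ∀ e ∈ gg, G e = GP e + a • GT e + b • GD e) :
    ∑ e ∈ gg, ((kap e : ℝ) : ℂ) • G e =
      ∑ e ∈ gg, ((kap e : ℝ) : ℂ) • GP e + a • ∑ e ∈ gg, ((kap e : ℝ) : ℂ) • GT e +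
        b • ∑ e ∈ gg, ((kap e : ℝ) : ℂ) • GD e := by
  rw [Finset.smul_sum, Finset.smul_sum, ← Finset.sum_add_distrib, ← Finset.sum_add_distrib]
  refine Finset.sum_congr rfl fun e he => ?_
  rw [hG e he]
  module


/-- The matrix-cut («eeb-mat») extra row of `TorusGibbsMatrixCuts`
(`Σᵢⱼ Λᴬᵢⱼ Ãᵢᴴ Ãⱼ + Λᴮᵢⱼ Ãⱼ Ãᵢᴴ + β Λᶜᵢⱼ Ãᵢᴴ (H Ãⱼ − Ãⱼ H)`) for `H = H_P + a H_T + b H_D` splits as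
`row(H_P) + a · (β Σᵢⱼ Λᶜᵢⱼ Ãᵢᴴ (H_T Ãⱼ − Ãⱼ H_T)) + b · (β Σᵢⱼ Λᶜᵢⱼ Ãᵢᴴ (H_D Ãⱼ − Ãⱼ H_D))` — the affine
split `Gₑ = G^P_ₑ + a G^T_ₑ + b G^D_ₑ` the transport theorems below ask for. [cite: FawziFawziScalet2024, §3.3] -/
theorem matrixCutRow_of_add_smul_smul {Λ Λ' : Finset (Site 2)} (hΛ : Λ ⊆ Λ') {H HP HT HD : FermionOp Λ'}
    {a b : ℂ} (hH : H = HP + a • HT + b • HD) {m : Type*} [Fintype m] (ag : m → FermionOp Λ)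
    (ΛA ΛB ΛC : Matrix m m ℂ) (β : ℝ) :
    ∑ i, ∑ j, (ΛA i j • ((fermionEmbed (PolySite.incl hΛ) (ag i))ᴴ * fermionEmbed (PolySite.incl hΛ) (ag j)) +
        ΛB i j • (fermionEmbed (PolySite.incl hΛ) (ag j) * (fermionEmbed (PolySite.incl hΛ) (ag i))ᴴ) +
        ((β : ℝ) : ℂ) • (ΛC i j • ((fermionEmbed (PolySite.incl hΛ) (ag i))ᴴ *
          (H * fermionEmbed (PolySite.incl hΛ) (ag j) - fermionEmbed (PolySite.incl hΛ) (ag j) * H)))) =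
      ∑ i, ∑ j, (ΛA i j • ((fermionEmbed (PolySite.incl hΛ) (ag i))ᴴ * fermionEmbed (PolySite.incl hΛ) (ag j)) +
          ΛB i j • (fermionEmbed (PolySite.incl hΛ) (ag j) * (fermionEmbed (PolySite.incl hΛ) (ag i))ᴴ) +
          ((β : ℝ) : ℂ) • (ΛC i j • ((fermionEmbed (PolySite.incl hΛ) (ag i))ᴴ *
            (HP * fermionEmbed (PolySite.incl hΛ) (ag j) - fermionEmbed (PolySite.incl hΛ) (ag j) * HP)))) +
        a • ∑ i, ∑ j, ((β : ℝ) : ℂ) • (ΛC i j • ((fermionEmbed (PolySite.incl hΛ) (ag i))ᴴ *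
            (HT * fermionEmbed (PolySite.incl hΛ) (ag j) - fermionEmbed (PolySite.incl hΛ) (ag j) * HT))) +
        b • ∑ i, ∑ j, ((β : ℝ) : ℂ) • (ΛC i j • ((fermionEmbed (PolySite.incl hΛ) (ag i))ᴴ *
            (HD * fermionEmbed (PolySite.incl hΛ) (ag j) - fermionEmbed (PolySite.incl hΛ) (ag j) * HD))) := by
  rw [Finset.smul_sum, Finset.smul_sum, ← Finset.sum_add_distrib, ← Finset.sum_add_distrib]
  refine Finset.sum_congr rfl fun i _ => ?_
  rw [Finset.smul_sum, Finset.smul_sum, ← Finset.sum_add_distrib, ← Finset.sum_add_distrib]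
  refine Finset.sum_congr rfl fun j _ => ?_
  rw [hH, commutator_add_smul_smul_expand HP HT HD _ a b, mul_add, mul_add, mul_smul_comm, mul_smul_comm]
  module

/-! ### §1 The exact transport identity of a thermal certificate to any target `(t'_P, U_P)` -/

/-- **Two-coupling transport identity of a THERMAL `t–t'` window certificate** (full-symmetry format of
`re_expect_ge_of_thermal_certificate_symm_TT'_of_rows`). A thermal window identity at the anchor
`(t, t'_A, U_A)` — objective `Xw`, constant `c`, cap `u`, multiplier `κ`, density block `M`, Gram part `G`,
eom generators `Bₖ`, coupling-free null rows `SY` (defects, charged words, spin flips, generic nulls), EEB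
rows `(λᵣ, Aᵣ, sᵣ, qᵣ)` at inverse temperature `β`, extra rows `κₑ Gₑ` with an affine split
`Gₑ = G^P_ₑ + (t'_A − t'_P) G^T_ₑ + (U_A − U_P) G^D_ₑ`, residual block `R` — IS, for every target
`(t'_P, U_P)`, a thermal window identity at `(t, t'_P, U_P)` with the same data, extra rows `G^P_ₑ`, and
objective `Xw + (t'_A − t'_P)(κ ΓE_{Φ(0,1,0)} − W_{t'} − V_{t'} − X_{t'}) + (U_A − U_P)(κ ΓE_{Φ(0,0,1)} − W_U − V_U − X_U)`,
`W = Σₖ (H_{Λ'}(·) ΓBₖ − ΓBₖ H_{Λ'}(·))` the eom charges, `V = β Σᵣ λᵣ (ΓAᵣ)ᴴ(H_{Λ'}(·) ΓAᵣ − ΓAᵣ H_{Λ'}(·))`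
the EEB charges, `X = Σₑ κₑ G^{T/D}_ₑ` the extra-row charges (`H_{Λ'}(·)` the local Hamiltonian of
`Φ(0,1,0)` resp. `Φ(0,0,1)`) — because the interaction, hence the local Hamiltonians, the mean-energy
observable, the eom rows and the EEB commutators, are affine in `(t', U)`.
[cite: FawziFawziScalet2024, §3.2] [cite: WangEtAl2024, §III] -/
theorem thermalCertificate_TT'_transport (t t'A UA t'P UP β : ℝ)
    {Λ Λ' : Finset (Site 2)} (hΛ : Λ ⊆ Λ') (h0 : thicken ({0} : Finset (Site 2)) 1 ⊆ Λ')
    (Xw M G SY R : FermionOp Λ') (κ u : ℝ) {κ' : Type*} (s : Finset κ') (B : κ' → FermionOp Λ)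
    {θ : Type*} (rr : Finset θ) (lam : θ → ℝ) (A : θ → FermionOp Λ) (sv qv : θ → ℝ)
    {η : Type*} (gg : Finset η) (kap : η → ℝ) (G' GP GT GD : η → FermionOp Λ')
    (hGsplit : ∀ e ∈ gg, G' e = GP e + ((t'A - t'P : ℝ) : ℂ) • GT e + ((UA - UP : ℝ) : ℂ) • GD e) {c : ℝ}
    (hcert : Xw - (c : ℂ) • (1 : FermionOp Λ') - M -
        ((κ : ℝ) : ℂ) • (((u : ℝ) : ℂ) • (1 : FermionOp Λ') -
          fermionEmbed (PolySite.incl h0) ((hubbardTTPrimeFermionInteraction t t'A UA).meanEnergyObs 1)) =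
      G +
        (∑ k ∈ s, ((hubbardTTPrimeFermionInteraction t t'A UA).localHamiltonian Λ' * fermionEmbed (PolySite.incl hΛ) (B k) -
            fermionEmbed (PolySite.incl hΛ) (B k) * (hubbardTTPrimeFermionInteraction t t'A UA).localHamiltonian Λ') +
          SY) +
        (∑ r ∈ rr, ((lam r : ℝ) : ℂ) •
            (((β : ℝ) : ℂ) • ((fermionEmbed (PolySite.incl hΛ) (A r))ᴴ *
                ((hubbardTTPrimeFermionInteraction t t'A UA).localHamiltonian Λ' * fermionEmbed (PolySite.incl hΛ) (A r) -
                  fermionEmbed (PolySite.incl hΛ) (A r) * (hubbardTTPrimeFermionInteraction t t'A UA).localHamiltonian Λ')) -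
              ((sv r : ℝ) : ℂ) • ((fermionEmbed (PolySite.incl hΛ) (A r))ᴴ * fermionEmbed (PolySite.incl hΛ) (A r)) +
              ((qv r : ℝ) : ℂ) • (fermionEmbed (PolySite.incl hΛ) (A r) * (fermionEmbed (PolySite.incl hΛ) (A r))ᴴ)) +
          ∑ e ∈ gg, ((kap e : ℝ) : ℂ) • G' e) +
        R) :
    (Xw + ((t'A - t'P : ℝ) : ℂ) •
        (((κ : ℝ) : ℂ) • fermionEmbed (PolySite.incl h0) ((hubbardTTPrimeFermionInteraction 0 1 0).meanEnergyObs 1) -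
          ∑ k ∈ s, ((hubbardTTPrimeFermionInteraction 0 1 0).localHamiltonian Λ' * fermionEmbed (PolySite.incl hΛ) (B k) -
            fermionEmbed (PolySite.incl hΛ) (B k) * (hubbardTTPrimeFermionInteraction 0 1 0).localHamiltonian Λ') -
          ∑ r ∈ rr, ((lam r : ℝ) : ℂ) • (((β : ℝ) : ℂ) • ((fermionEmbed (PolySite.incl hΛ) (A r))ᴴ *
            ((hubbardTTPrimeFermionInteraction 0 1 0).localHamiltonian Λ' * fermionEmbed (PolySite.incl hΛ) (A r) -
              fermionEmbed (PolySite.incl hΛ) (A r) * (hubbardTTPrimeFermionInteraction 0 1 0).localHamiltonian Λ'))) -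
          ∑ e ∈ gg, ((kap e : ℝ) : ℂ) • GT e) +
      ((UA - UP : ℝ) : ℂ) •
        (((κ : ℝ) : ℂ) • fermionEmbed (PolySite.incl h0) ((hubbardTTPrimeFermionInteraction 0 0 1).meanEnergyObs 1) -
          ∑ k ∈ s, ((hubbardTTPrimeFermionInteraction 0 0 1).localHamiltonian Λ' * fermionEmbed (PolySite.incl hΛ) (B k) -
            fermionEmbed (PolySite.incl hΛ) (B k) * (hubbardTTPrimeFermionInteraction 0 0 1).localHamiltonian Λ') -
          ∑ r ∈ rr, ((lam r : ℝ) : ℂ) • (((β : ℝ) : ℂ) • ((fermionEmbed (PolySite.incl hΛ) (A r))ᴴ *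
            ((hubbardTTPrimeFermionInteraction 0 0 1).localHamiltonian Λ' * fermionEmbed (PolySite.incl hΛ) (A r) -
              fermionEmbed (PolySite.incl hΛ) (A r) * (hubbardTTPrimeFermionInteraction 0 0 1).localHamiltonian Λ'))) -
          ∑ e ∈ gg, ((kap e : ℝ) : ℂ) • GD e)) -
        (c : ℂ) • (1 : FermionOp Λ') - M -
        ((κ : ℝ) : ℂ) • (((u : ℝ) : ℂ) • (1 : FermionOp Λ') -
          fermionEmbed (PolySite.incl h0) ((hubbardTTPrimeFermionInteraction t t'P UP).meanEnergyObs 1)) =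
      G +
        (∑ k ∈ s, ((hubbardTTPrimeFermionInteraction t t'P UP).localHamiltonian Λ' * fermionEmbed (PolySite.incl hΛ) (B k) -
            fermionEmbed (PolySite.incl hΛ) (B k) * (hubbardTTPrimeFermionInteraction t t'P UP).localHamiltonian Λ') +
          SY) +
        (∑ r ∈ rr, ((lam r : ℝ) : ℂ) •
            (((β : ℝ) : ℂ) • ((fermionEmbed (PolySite.incl hΛ) (A r))ᴴ *
                ((hubbardTTPrimeFermionInteraction t t'P UP).localHamiltonian Λ' * fermionEmbed (PolySite.incl hΛ) (A r) -
                  fermionEmbed (PolySite.incl hΛ) (A r) * (hubbardTTPrimeFermionInteraction t t'P UP).localHamiltonian Λ')) -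
              ((sv r : ℝ) : ℂ) • ((fermionEmbed (PolySite.incl hΛ) (A r))ᴴ * fermionEmbed (PolySite.incl hΛ) (A r)) +
              ((qv r : ℝ) : ℂ) • (fermionEmbed (PolySite.incl hΛ) (A r) * (fermionEmbed (PolySite.incl hΛ) (A r))ᴴ)) +
          ∑ e ∈ gg, ((kap e : ℝ) : ℂ) • GP e) +
        R := by
  -- the interaction at the anchor, expanded at the target
  have hΦ : ∀ X, (hubbardTTPrimeFermionInteraction t t'A UA).Φ X =
      (hubbardTTPrimeFermionInteraction t t'P UP).Φ X +
        ((t'A - t'P : ℝ) : ℂ) • (hubbardTTPrimeFermionInteraction 0 1 0).Φ X +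
        ((UA - UP : ℝ) : ℂ) • (hubbardTTPrimeFermionInteraction 0 0 1).Φ X :=
    fun X => hubbardTTPrimeFermionInteraction_taylor t t'A UA t'P UP X
  have hH := FermionInteraction.localHamiltonian_of_add_smul_smul hΦ Λ'
  have hE : fermionEmbed (PolySite.incl h0) ((hubbardTTPrimeFermionInteraction t t'A UA).meanEnergyObs 1) =
      fermionEmbed (PolySite.incl h0) ((hubbardTTPrimeFermionInteraction t t'P UP).meanEnergyObs 1) +
        ((t'A - t'P : ℝ) : ℂ) • fermionEmbed (PolySite.incl h0) ((hubbardTTPrimeFermionInteraction 0 1 0).meanEnergyObs 1) +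
        ((UA - UP : ℝ) : ℂ) • fermionEmbed (PolySite.incl h0) ((hubbardTTPrimeFermionInteraction 0 0 1).meanEnergyObs 1) := by
    rw [FermionInteraction.meanEnergyObs_of_add_smul_smul hΦ 1, map_add, map_add, map_smul, map_smul]
  exact transport_identity_of_affine_rows Xw M G SY R _ _ _ _ _ _ _ _ _ _ _ _ _ _ _ _ c u κ _ _ hE
    (eomRows_of_add_smul_smul hΛ hH s B) (eebRows_of_add_smul_smul hΛ hH rr lam A β sv qv)
    (extraRows_of_split gg kap G' GP GT GD hGsplit) hcert


/-! ### §2 Soundness at the target: every thermal torus limit at `(t'_P, U_P)`, explicit conjugate terms -/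

namespace InfVolFermionState

/-- **One thermal certificate at `(t'_A, U_A)` bounds the objective in the thermal torus-limit states at
any `(t'_P, U_P)`.** Data: the full-symmetry thermal window identity of
`re_expect_ge_of_thermal_certificate_symm_TT'_of_rows` issued at the anchor `(t, t'_A, U_A)` at inverse
temperature `β` (eom generators `Bₖ`; EEB generators `Aᵣ` conserving the local `N` and `S^z`,
`e^{sᵣ−1} ≤ qᵣ`, `λᵣ ≥ 0`; extra rows `κₑ Gₑ`, `κₑ ≥ 0`, with an affine split
`Gₑ = G^P_ₑ + (t'_A − t'_P) G^T_ₑ + (U_A − U_P) G^D_ₑ` whose target parts `G^P_ₑ` are nonnegative on `ω`);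
`ω` a torus limit of the canonical Gibbs states of `hubbardTorusTT' (Ls j) t t'_P U_P` at the SAME `β` on
the sectors `(rectN n (Ls j), S^z = 0)` (`0 ≤ n ≤ 2`, `Ls → ∞`), killing the generic nulls `N_z`. Then
`c − Σₖ ‖aₖ‖ + (Σ_σ μ_σ)(n/2 − ν) + κ (u − e^{t t'_P U_P}(ω)) − (t'_A − t'_P) κ K₂(ω) − (U_A − U_P) κ D(ω)
   + (t'_A − t'_P) Re ω_{Λ'}(W_{t'} + V_{t'} + X_{t'}) + (U_A − U_P) Re ω_{Λ'}(W_U + V_U + X_U) ≤ Re ω_{Λ'}(Xw)`,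
`K₂(ω) = e_{Φ(0,1,0)}(ω)`, `D(ω) = e_{Φ(0,0,1)}(ω) = Re ω(n_{0↑}n_{0↓})`
(`IsTorusLimitOfMixture.meanEnergy_onSite_eq_re_expect_docc`); `W` = eom charges, `V` = EEB charges
(`β Σᵣ λᵣ (ΓAᵣ)ᴴ(H_{Λ'}(0,·,·)ΓAᵣ − ΓAᵣ H_{Λ'}(0,·,·))`), `X = Σₑ κₑ G^{T/D}_ₑ`. The first three energy
terms equal `κ (u − e^{t t'_A U_A}(ω))` (`meanEnergy_hubbardTTPrime_affine`). Proof: the transported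
identity (§1) is read at the target by `…re_expect_ge_of_thermal_certificate_symm_TT'_of_sectorGibbs` (every
row of the TARGET Hamiltonian is discharged there: stationarity, EEB, symmetry, gauge). The `T > 0` twin of
`IsTorusLimitOf.re_expect_ge_of_window_certificate_TT'_ineq_transport`.
[cite: FawziFawziScalet2024, Thm. 3.6] [cite: KomaTasaki1994, §1] -/
theorem IsTorusLimitOfMixture.re_expect_ge_of_thermal_certificate_symm_TT'_transport
    (t t'A UA t'P UP : ℝ) {n : ℝ} (hn0 : 0 ≤ n) (hn2 : n ≤ 2) (β : ℝ)
    {ω : InfVolFermionState 2} {Ls : ℕ → ℕ}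
    (h : ω.IsTorusLimitOfMixture (sectorGibbsCount n) (fun L => sectorGibbsWeightTT' β t t'P UP n L)
      (fun L => sectorGibbsVectorTT' t t'P UP n L) Ls)
    (hLs : Tendsto Ls atTop atTop)
    {Λ Λ' : Finset (Site 2)} (hΛ : Λ ⊆ Λ') (h8 : thicken Λ 1 ⊆ Λ')
    (h0 : thicken ({0} : Finset (Site 2)) 1 ⊆ Λ') (hz : (0 : Site 2) ∈ Λ')
    (Xw : FermionOp Λ') (κ u : ℝ) (μ : Fin 2 → ℝ) (ν : ℝ)
    {m : Type*} [Fintype m] [DecidableEq m] {Λm : Matrix m m ℂ} (hΛm : Λm.PosSemidef)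
    (O : m → FermionOp Λ')
    {κ' : Type*} (s : Finset κ') (B : κ' → FermionOp Λ)
    {ι : Type*} (tt : Finset ι) (γ : ι → DihedralGroup 4) (wv : ι → Site 2)
    (hsh : ∀ l, d4ShiftSet (γ l) (wv l) Λ ⊆ Λ') (Y : ι → FermionOp Λ)
    {ρ : Type*} (uu : Finset ρ) (b : ρ → ℂ) (cw : ρ → List (Orb (PolySite Λ') × Bool))
    (hcw : ∀ j ∈ uu, ladderCharge (cw j) ≠ 0 ∨ ladderSpinCharge (cw j) ≠ 0)
    {φ : Type*} (ff : Finset φ) (Yf : φ → FermionOp Λ')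
    {ζ : Type*} (zz : Finset ζ) (Nz : ζ → FermionOp Λ') (hnull : ∀ z ∈ zz, ω.expect Λ' (Nz z) = 0)
    {θ : Type*} (rr : Finset θ) (lam : θ → ℝ) (hlam : ∀ r ∈ rr, 0 ≤ lam r) (A : θ → FermionOp Λ)
    (hAN : ∀ r ∈ rr, Commute (A r) (totalNumber : FermionOp Λ))
    (hAS : ∀ r ∈ rr, Commute (A r) (HubbardWave0.spinZ : FermionOp Λ))
    (sv qv : θ → ℝ) (hq : ∀ r ∈ rr, Real.exp (sv r - 1) ≤ qv r)
    {η : Type*} (gg : Finset η) (kap : η → ℝ) (hkap : ∀ e ∈ gg, 0 ≤ kap e) (G GP GT GD : η → FermionOp Λ')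
    (hGsplit : ∀ e ∈ gg, G e = GP e + ((t'A - t'P : ℝ) : ℂ) • GT e + ((UA - UP : ℝ) : ℂ) • GD e)
    (hGP : ∀ e ∈ gg, 0 ≤ (ω.expect Λ' (GP e)).re)
    {δ : Type*} (ah : Finset δ) (dc : δ → ℝ) (V : δ → FermionOp Λ')
    {κ'' : Type*} (w : Finset κ'') (a : κ'' → ℂ) (word : κ'' → List (Orb (PolySite Λ') × Bool)) {c : ℝ}
    (hcert : Xw - (c : ℂ) • (1 : FermionOp Λ') -
        ∑ σ : Fin 2, ((μ σ : ℝ) : ℂ) • (nAt 0 hz σ - ((ν : ℝ) : ℂ) • (1 : FermionOp Λ')) -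
        ((κ : ℝ) : ℂ) • (((u : ℝ) : ℂ) • (1 : FermionOp Λ') -
          fermionEmbed (PolySite.incl h0) ((hubbardTTPrimeFermionInteraction t t'A UA).meanEnergyObs 1)) =
      gramForm Λm O +
        (∑ k ∈ s, ((hubbardTTPrimeFermionInteraction t t'A UA).localHamiltonian Λ' * fermionEmbed (PolySite.incl hΛ) (B k) -
            fermionEmbed (PolySite.incl hΛ) (B k) * (hubbardTTPrimeFermionInteraction t t'A UA).localHamiltonian Λ') +
          ∑ l ∈ tt, (fermionEmbed (PolySite.incl (hsh l)) (fermionEmbed (PolySite.d4Emb (γ l) (wv l) Λ) (Y l)) -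
            fermionEmbed (PolySite.incl hΛ) (Y l)) +
          ∑ j ∈ uu, b j • ladderWord (cw j) +
          ∑ f ∈ ff, (relabel (Orb.spinSwap : Orb (PolySite Λ') ≃ Orb (PolySite Λ')) (Yf f) - Yf f) +
          ∑ z ∈ zz, Nz z) +
        (∑ r ∈ rr, ((lam r : ℝ) : ℂ) •
            (((β : ℝ) : ℂ) • ((fermionEmbed (PolySite.incl hΛ) (A r))ᴴ *
                ((hubbardTTPrimeFermionInteraction t t'A UA).localHamiltonian Λ' * fermionEmbed (PolySite.incl hΛ) (A r) -
                  fermionEmbed (PolySite.incl hΛ) (A r) * (hubbardTTPrimeFermionInteraction t t'A UA).localHamiltonian Λ')) -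
              ((sv r : ℝ) : ℂ) • ((fermionEmbed (PolySite.incl hΛ) (A r))ᴴ * fermionEmbed (PolySite.incl hΛ) (A r)) +
              ((qv r : ℝ) : ℂ) • (fermionEmbed (PolySite.incl hΛ) (A r) * (fermionEmbed (PolySite.incl hΛ) (A r))ᴴ)) +
          ∑ e ∈ gg, ((kap e : ℝ) : ℂ) • G e) +
        (∑ m' ∈ ah, ((dc m' : ℝ) : ℂ) • ((V m')ᴴ - V m') + ∑ k ∈ w, a k • ladderWord (word k))) :
    c - ∑ k ∈ w, ‖a k‖ + (∑ σ : Fin 2, μ σ) * (n / 2 - ν) +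
        κ * (u - ω.meanEnergy (hubbardTTPrimeFermionInteraction t t'P UP) 1) -
        (t'A - t'P) * κ * ω.meanEnergy (hubbardTTPrimeFermionInteraction 0 1 0) 1 -
        (UA - UP) * κ * ω.meanEnergy (hubbardTTPrimeFermionInteraction 0 0 1) 1 +
        (t'A - t'P) * ((ω.expect Λ' (∑ k ∈ s, ((hubbardTTPrimeFermionInteraction 0 1 0).localHamiltonian Λ' * fermionEmbed (PolySite.incl hΛ) (B k) -
            fermionEmbed (PolySite.incl hΛ) (B k) * (hubbardTTPrimeFermionInteraction 0 1 0).localHamiltonian Λ'))).re +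
          (ω.expect Λ' (∑ r ∈ rr, ((lam r : ℝ) : ℂ) • (((β : ℝ) : ℂ) • ((fermionEmbed (PolySite.incl hΛ) (A r))ᴴ *
            ((hubbardTTPrimeFermionInteraction 0 1 0).localHamiltonian Λ' * fermionEmbed (PolySite.incl hΛ) (A r) -
              fermionEmbed (PolySite.incl hΛ) (A r) * (hubbardTTPrimeFermionInteraction 0 1 0).localHamiltonian Λ'))))).re +
          (ω.expect Λ' (∑ e ∈ gg, ((kap e : ℝ) : ℂ) • GT e)).re) +
        (UA - UP) * ((ω.expect Λ' (∑ k ∈ s, ((hubbardTTPrimeFermionInteraction 0 0 1).localHamiltonian Λ' * fermionEmbed (PolySite.incl hΛ) (B k) -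
            fermionEmbed (PolySite.incl hΛ) (B k) * (hubbardTTPrimeFermionInteraction 0 0 1).localHamiltonian Λ'))).re +
          (ω.expect Λ' (∑ r ∈ rr, ((lam r : ℝ) : ℂ) • (((β : ℝ) : ℂ) • ((fermionEmbed (PolySite.incl hΛ) (A r))ᴴ *
            ((hubbardTTPrimeFermionInteraction 0 0 1).localHamiltonian Λ' * fermionEmbed (PolySite.incl hΛ) (A r) -
              fermionEmbed (PolySite.incl hΛ) (A r) * (hubbardTTPrimeFermionInteraction 0 0 1).localHamiltonian Λ'))))).re +
          (ω.expect Λ' (∑ e ∈ gg, ((kap e : ℝ) : ℂ) • GD e)).re) ≤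
      (ω.expect Λ' Xw).re := by
  -- the transported identity at `(t'_P, U_P)`
  have hcert' := thermalCertificate_TT'_transport t t'A UA t'P UP β hΛ h0 Xw
    (∑ σ : Fin 2, ((μ σ : ℝ) : ℂ) • (nAt 0 hz σ - ((ν : ℝ) : ℂ) • (1 : FermionOp Λ'))) (gramForm Λm O)
    (∑ l ∈ tt, (fermionEmbed (PolySite.incl (hsh l)) (fermionEmbed (PolySite.d4Emb (γ l) (wv l) Λ) (Y l)) -
        fermionEmbed (PolySite.incl hΛ) (Y l)) +
      ∑ j ∈ uu, b j • ladderWord (cw j) +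
      ∑ f ∈ ff, (relabel (Orb.spinSwap : Orb (PolySite Λ') ≃ Orb (PolySite Λ')) (Yf f) - Yf f) +
      ∑ z ∈ zz, Nz z)
    (∑ m' ∈ ah, ((dc m' : ℝ) : ℂ) • ((V m')ᴴ - V m') + ∑ k ∈ w, a k • ladderWord (word k)) κ u s B rr lam A
    sv qv gg kap G GP GT GD hGsplit (c := c) (by rw [hcert]; abel)
  -- the reader at the target, applied to the transported identity (extra rows `G^P_ₑ`)
  have hmain := h.re_expect_ge_of_thermal_certificate_symm_TT'_of_sectorGibbs t t'P UP hn0 hn2 β hLs hΛ h8 h0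
    hz _ κ u μ ν hΛm O s B tt γ wv hsh Y uu b cw hcw ff Yf zz Nz hnull rr lam hlam A hAN hAS sv qv hq gg kap
    hkap GP hGP ah dc V w a word (c := c) (by rw [hcert']; abel)
  -- read the transported objective in `ω`
  have hET : (ω.expect Λ' (fermionEmbed (PolySite.incl h0) ((hubbardTTPrimeFermionInteraction 0 1 0).meanEnergyObs 1))).re =
      ω.meanEnergy (hubbardTTPrimeFermionInteraction 0 1 0) 1 := by
    rw [ω.compatible h0]
    rfl
  have hED : (ω.expect Λ' (fermionEmbed (PolySite.incl h0) ((hubbardTTPrimeFermionInteraction 0 0 1).meanEnergyObs 1))).re =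
      ω.meanEnergy (hubbardTTPrimeFermionInteraction 0 0 1) 1 := by
    rw [ω.compatible h0]
    rfl
  have hread : (ω.expect Λ' (Xw + ((t'A - t'P : ℝ) : ℂ) •
        (((κ : ℝ) : ℂ) • fermionEmbed (PolySite.incl h0) ((hubbardTTPrimeFermionInteraction 0 1 0).meanEnergyObs 1) -
          ∑ k ∈ s, ((hubbardTTPrimeFermionInteraction 0 1 0).localHamiltonian Λ' * fermionEmbed (PolySite.incl hΛ) (B k) -
            fermionEmbed (PolySite.incl hΛ) (B k) * (hubbardTTPrimeFermionInteraction 0 1 0).localHamiltonian Λ') -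
          ∑ r ∈ rr, ((lam r : ℝ) : ℂ) • (((β : ℝ) : ℂ) • ((fermionEmbed (PolySite.incl hΛ) (A r))ᴴ *
            ((hubbardTTPrimeFermionInteraction 0 1 0).localHamiltonian Λ' * fermionEmbed (PolySite.incl hΛ) (A r) -
              fermionEmbed (PolySite.incl hΛ) (A r) * (hubbardTTPrimeFermionInteraction 0 1 0).localHamiltonian Λ'))) -
          ∑ e ∈ gg, ((kap e : ℝ) : ℂ) • GT e) +
      ((UA - UP : ℝ) : ℂ) •
        (((κ : ℝ) : ℂ) • fermionEmbed (PolySite.incl h0) ((hubbardTTPrimeFermionInteraction 0 0 1).meanEnergyObs 1) -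
          ∑ k ∈ s, ((hubbardTTPrimeFermionInteraction 0 0 1).localHamiltonian Λ' * fermionEmbed (PolySite.incl hΛ) (B k) -
            fermionEmbed (PolySite.incl hΛ) (B k) * (hubbardTTPrimeFermionInteraction 0 0 1).localHamiltonian Λ') -
          ∑ r ∈ rr, ((lam r : ℝ) : ℂ) • (((β : ℝ) : ℂ) • ((fermionEmbed (PolySite.incl hΛ) (A r))ᴴ *
            ((hubbardTTPrimeFermionInteraction 0 0 1).localHamiltonian Λ' * fermionEmbed (PolySite.incl hΛ) (A r) -
              fermionEmbed (PolySite.incl hΛ) (A r) * (hubbardTTPrimeFermionInteraction 0 0 1).localHamiltonian Λ'))) -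
          ∑ e ∈ gg, ((kap e : ℝ) : ℂ) • GD e))).re =
      (ω.expect Λ' Xw).re +
        (t'A - t'P) * κ * ω.meanEnergy (hubbardTTPrimeFermionInteraction 0 1 0) 1 +
        (UA - UP) * κ * ω.meanEnergy (hubbardTTPrimeFermionInteraction 0 0 1) 1 -
        (t'A - t'P) * ((ω.expect Λ' (∑ k ∈ s, ((hubbardTTPrimeFermionInteraction 0 1 0).localHamiltonian Λ' * fermionEmbed (PolySite.incl hΛ) (B k) -
            fermionEmbed (PolySite.incl hΛ) (B k) * (hubbardTTPrimeFermionInteraction 0 1 0).localHamiltonian Λ'))).re +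
          (ω.expect Λ' (∑ r ∈ rr, ((lam r : ℝ) : ℂ) • (((β : ℝ) : ℂ) • ((fermionEmbed (PolySite.incl hΛ) (A r))ᴴ *
            ((hubbardTTPrimeFermionInteraction 0 1 0).localHamiltonian Λ' * fermionEmbed (PolySite.incl hΛ) (A r) -
              fermionEmbed (PolySite.incl hΛ) (A r) * (hubbardTTPrimeFermionInteraction 0 1 0).localHamiltonian Λ'))))).re +
          (ω.expect Λ' (∑ e ∈ gg, ((kap e : ℝ) : ℂ) • GT e)).re) -
        (UA - UP) * ((ω.expect Λ' (∑ k ∈ s, ((hubbardTTPrimeFermionInteraction 0 0 1).localHamiltonian Λ' * fermionEmbed (PolySite.incl hΛ) (B k) -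
            fermionEmbed (PolySite.incl hΛ) (B k) * (hubbardTTPrimeFermionInteraction 0 0 1).localHamiltonian Λ'))).re +
          (ω.expect Λ' (∑ r ∈ rr, ((lam r : ℝ) : ℂ) • (((β : ℝ) : ℂ) • ((fermionEmbed (PolySite.incl hΛ) (A r))ᴴ *
            ((hubbardTTPrimeFermionInteraction 0 0 1).localHamiltonian Λ' * fermionEmbed (PolySite.incl hΛ) (A r) -
              fermionEmbed (PolySite.incl hΛ) (A r) * (hubbardTTPrimeFermionInteraction 0 0 1).localHamiltonian Λ'))))).re +
          (ω.expect Λ' (∑ e ∈ gg, ((kap e : ℝ) : ℂ) • GD e)).re) := by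
    simp only [map_add, map_sub, map_smul, smul_eq_mul, Complex.add_re, Complex.sub_re, Complex.re_ofReal_mul]
    rw [hET, hED]
    ring
  rw [hread] at hmain
  linarith


/-! ### §3 Priced form: a cap at the target, certified brackets for `K₂(ω)`, `D(ω)`, norms for the charges -/

/-- Sign-split pricing of a slope term: `x κ τ ≤ max (x κ τlo) (x κ τhi)` for `κ ≥ 0`, `τ ∈ [τlo, τhi]`.
[folklore] [cite: KomaTasaki1994, §1] -/
private theorem mul_mul_le_max_of_mem' {x κ τ τlo τhi : ℝ} (hκ : 0 ≤ κ) (hlo : τlo ≤ τ) (hhi : τ ≤ τhi) :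
    x * κ * τ ≤ max (x * κ * τlo) (x * κ * τhi) := by
  rcases le_total 0 x with hp | hm
  · exact (mul_le_mul_of_nonneg_left hhi (mul_nonneg hp hκ)).trans (le_max_right _ _)
  · exact (mul_le_mul_of_nonpos_left hlo (mul_nonpos_of_nonpos_of_nonneg hm hκ)).trans (le_max_left _ _)

open scoped Matrix.Norms.L2Operator in
/-- Norm pricing of a charge term: `−|x| ‖W‖ ≤ x Re ω(W)`. [cite: BratteliRobinsonI1987, Prop. 2.3.11] -/
private theorem neg_abs_mul_norm_le_mul_re_expect' (ω : InfVolFermionState 2) {Λ' : Finset (Site 2)}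
    (x : ℝ) (W : FermionOp Λ') : -(|x| * ‖W‖) ≤ x * (ω.expect Λ' W).re := by
  have h1 : |x * (ω.expect Λ' W).re| ≤ |x| * ‖W‖ := by
    rw [abs_mul]
    exact mul_le_mul_of_nonneg_left (ω.abs_re_expect_le Λ' W) (abs_nonneg _)
  exact (abs_le.1 h1).1

open scoped Matrix.Norms.L2Operator in
/-- **Priced thermal transport.** Under the hypotheses of `…_transport` with `κ ≥ 0`: a cap
`e^{t t'_P U_P}(ω) ≤ u'` on the TARGET thermal energy (e.g. the kinematic
`energyDensityTT' t t'_P U_P n + 2H_b(n/2)/β`, or a certified thermal cap at `P`), certified brackets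
`K₂(ω) ∈ [τlo, τhi]`, `D(ω) ∈ [dlo, dhi]` (e.g. the kinematic rows of `TorusSectorGibbsMixture` §4, or the
`U`-box docc words of `HubbardTTPrimeDoccTransportThermal` §3 / the `t'`-box `K₂` words of
`HubbardTTPrimeDiagHopTransportThermal`), and the L²-operator norms of the two total charges give
`c + κ(u − u') − Σₖ ‖aₖ‖ + (Σ_σ μ_σ)(n/2 − ν) − max((t'_A−t'_P)κτlo, (t'_A−t'_P)κτhi)
   − max((U_A−U_P)κ dlo, (U_A−U_P)κ dhi) − |t'_A − t'_P| ‖W_{t'} + V_{t'} + X_{t'}‖ − |U_A − U_P| ‖W_U + V_U + X_U‖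
   ≤ Re ω_{Λ'}(Xw)`. [cite: FawziFawziScalet2024, Thm. 3.6] [cite: KomaTasaki1994, §1] -/
theorem IsTorusLimitOfMixture.re_expect_ge_of_thermal_certificate_symm_TT'_transport_priced
    (t t'A UA t'P UP : ℝ) {n : ℝ} (hn0 : 0 ≤ n) (hn2 : n ≤ 2) (β : ℝ)
    {ω : InfVolFermionState 2} {Ls : ℕ → ℕ}
    (h : ω.IsTorusLimitOfMixture (sectorGibbsCount n) (fun L => sectorGibbsWeightTT' β t t'P UP n L)
      (fun L => sectorGibbsVectorTT' t t'P UP n L) Ls)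
    (hLs : Tendsto Ls atTop atTop)
    {Λ Λ' : Finset (Site 2)} (hΛ : Λ ⊆ Λ') (h8 : thicken Λ 1 ⊆ Λ')
    (h0 : thicken ({0} : Finset (Site 2)) 1 ⊆ Λ') (hz : (0 : Site 2) ∈ Λ')
    (Xw : FermionOp Λ') (κ u : ℝ) (μ : Fin 2 → ℝ) (ν : ℝ)
    {m : Type*} [Fintype m] [DecidableEq m] {Λm : Matrix m m ℂ} (hΛm : Λm.PosSemidef)
    (O : m → FermionOp Λ')
    {κ' : Type*} (s : Finset κ') (B : κ' → FermionOp Λ)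
    {ι : Type*} (tt : Finset ι) (γ : ι → DihedralGroup 4) (wv : ι → Site 2)
    (hsh : ∀ l, d4ShiftSet (γ l) (wv l) Λ ⊆ Λ') (Y : ι → FermionOp Λ)
    {ρ : Type*} (uu : Finset ρ) (b : ρ → ℂ) (cw : ρ → List (Orb (PolySite Λ') × Bool))
    (hcw : ∀ j ∈ uu, ladderCharge (cw j) ≠ 0 ∨ ladderSpinCharge (cw j) ≠ 0)
    {φ : Type*} (ff : Finset φ) (Yf : φ → FermionOp Λ')
    {ζ : Type*} (zz : Finset ζ) (Nz : ζ → FermionOp Λ') (hnull : ∀ z ∈ zz, ω.expect Λ' (Nz z) = 0)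
    {θ : Type*} (rr : Finset θ) (lam : θ → ℝ) (hlam : ∀ r ∈ rr, 0 ≤ lam r) (A : θ → FermionOp Λ)
    (hAN : ∀ r ∈ rr, Commute (A r) (totalNumber : FermionOp Λ))
    (hAS : ∀ r ∈ rr, Commute (A r) (HubbardWave0.spinZ : FermionOp Λ))
    (sv qv : θ → ℝ) (hq : ∀ r ∈ rr, Real.exp (sv r - 1) ≤ qv r)
    {η : Type*} (gg : Finset η) (kap : η → ℝ) (hkap : ∀ e ∈ gg, 0 ≤ kap e) (G GP GT GD : η → FermionOp Λ')
    (hGsplit : ∀ e ∈ gg, G e = GP e + ((t'A - t'P : ℝ) : ℂ) • GT e + ((UA - UP : ℝ) : ℂ) • GD e)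
    (hGP : ∀ e ∈ gg, 0 ≤ (ω.expect Λ' (GP e)).re)
    {δ : Type*} (ah : Finset δ) (dc : δ → ℝ) (V : δ → FermionOp Λ')
    {κ'' : Type*} (w : Finset κ'') (a : κ'' → ℂ) (word : κ'' → List (Orb (PolySite Λ') × Bool)) {c : ℝ}
    (hcert : Xw - (c : ℂ) • (1 : FermionOp Λ') -
        ∑ σ : Fin 2, ((μ σ : ℝ) : ℂ) • (nAt 0 hz σ - ((ν : ℝ) : ℂ) • (1 : FermionOp Λ')) -
        ((κ : ℝ) : ℂ) • (((u : ℝ) : ℂ) • (1 : FermionOp Λ') -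
          fermionEmbed (PolySite.incl h0) ((hubbardTTPrimeFermionInteraction t t'A UA).meanEnergyObs 1)) =
      gramForm Λm O +
        (∑ k ∈ s, ((hubbardTTPrimeFermionInteraction t t'A UA).localHamiltonian Λ' * fermionEmbed (PolySite.incl hΛ) (B k) -
            fermionEmbed (PolySite.incl hΛ) (B k) * (hubbardTTPrimeFermionInteraction t t'A UA).localHamiltonian Λ') +
          ∑ l ∈ tt, (fermionEmbed (PolySite.incl (hsh l)) (fermionEmbed (PolySite.d4Emb (γ l) (wv l) Λ) (Y l)) -
            fermionEmbed (PolySite.incl hΛ) (Y l)) +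
          ∑ j ∈ uu, b j • ladderWord (cw j) +
          ∑ f ∈ ff, (relabel (Orb.spinSwap : Orb (PolySite Λ') ≃ Orb (PolySite Λ')) (Yf f) - Yf f) +
          ∑ z ∈ zz, Nz z) +
        (∑ r ∈ rr, ((lam r : ℝ) : ℂ) •
            (((β : ℝ) : ℂ) • ((fermionEmbed (PolySite.incl hΛ) (A r))ᴴ *
                ((hubbardTTPrimeFermionInteraction t t'A UA).localHamiltonian Λ' * fermionEmbed (PolySite.incl hΛ) (A r) -
                  fermionEmbed (PolySite.incl hΛ) (A r) * (hubbardTTPrimeFermionInteraction t t'A UA).localHamiltonian Λ')) -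
              ((sv r : ℝ) : ℂ) • ((fermionEmbed (PolySite.incl hΛ) (A r))ᴴ * fermionEmbed (PolySite.incl hΛ) (A r)) +
              ((qv r : ℝ) : ℂ) • (fermionEmbed (PolySite.incl hΛ) (A r) * (fermionEmbed (PolySite.incl hΛ) (A r))ᴴ)) +
          ∑ e ∈ gg, ((kap e : ℝ) : ℂ) • G e) +
        (∑ m' ∈ ah, ((dc m' : ℝ) : ℂ) • ((V m')ᴴ - V m') + ∑ k ∈ w, a k • ladderWord (word k)))
    {u' : ℝ} (hκ : 0 ≤ κ) (hu' : ω.meanEnergy (hubbardTTPrimeFermionInteraction t t'P UP) 1 ≤ u')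
    {τlo τhi dlo dhi : ℝ}
    (hτ : τlo ≤ ω.meanEnergy (hubbardTTPrimeFermionInteraction 0 1 0) 1 ∧
      ω.meanEnergy (hubbardTTPrimeFermionInteraction 0 1 0) 1 ≤ τhi)
    (hd : dlo ≤ ω.meanEnergy (hubbardTTPrimeFermionInteraction 0 0 1) 1 ∧
      ω.meanEnergy (hubbardTTPrimeFermionInteraction 0 0 1) 1 ≤ dhi) :
    c + κ * (u - u') - ∑ k ∈ w, ‖a k‖ + (∑ σ : Fin 2, μ σ) * (n / 2 - ν) -
        max ((t'A - t'P) * κ * τlo) ((t'A - t'P) * κ * τhi) -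
        max ((UA - UP) * κ * dlo) ((UA - UP) * κ * dhi) -
        |t'A - t'P| * ‖(∑ k ∈ s, ((hubbardTTPrimeFermionInteraction 0 1 0).localHamiltonian Λ' * fermionEmbed (PolySite.incl hΛ) (B k) -
            fermionEmbed (PolySite.incl hΛ) (B k) * (hubbardTTPrimeFermionInteraction 0 1 0).localHamiltonian Λ') +
          ∑ r ∈ rr, ((lam r : ℝ) : ℂ) • (((β : ℝ) : ℂ) • ((fermionEmbed (PolySite.incl hΛ) (A r))ᴴ *
            ((hubbardTTPrimeFermionInteraction 0 1 0).localHamiltonian Λ' * fermionEmbed (PolySite.incl hΛ) (A r) -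
              fermionEmbed (PolySite.incl hΛ) (A r) * (hubbardTTPrimeFermionInteraction 0 1 0).localHamiltonian Λ'))) +
          ∑ e ∈ gg, ((kap e : ℝ) : ℂ) • GT e)‖ -
        |UA - UP| * ‖(∑ k ∈ s, ((hubbardTTPrimeFermionInteraction 0 0 1).localHamiltonian Λ' * fermionEmbed (PolySite.incl hΛ) (B k) -
            fermionEmbed (PolySite.incl hΛ) (B k) * (hubbardTTPrimeFermionInteraction 0 0 1).localHamiltonian Λ') +
          ∑ r ∈ rr, ((lam r : ℝ) : ℂ) • (((β : ℝ) : ℂ) • ((fermionEmbed (PolySite.incl hΛ) (A r))ᴴ *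
            ((hubbardTTPrimeFermionInteraction 0 0 1).localHamiltonian Λ' * fermionEmbed (PolySite.incl hΛ) (A r) -
              fermionEmbed (PolySite.incl hΛ) (A r) * (hubbardTTPrimeFermionInteraction 0 0 1).localHamiltonian Λ'))) +
          ∑ e ∈ gg, ((kap e : ℝ) : ℂ) • GD e)‖ ≤
      (ω.expect Λ' Xw).re := by
  have hm := h.re_expect_ge_of_thermal_certificate_symm_TT'_transport t t'A UA t'P UP hn0 hn2 β hLs hΛ h8 h0 hz Xw κ u μ ν hΛm O s B tt γ wv
    hsh Y uu b cw hcw ff Yf zz Nz hnull rr lam hlam A hAN hAS sv qv hq gg kap hkap G GP GT GD hGsplit hGP ah dc V w a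
    word hcert
  have hT := mul_mul_le_max_of_mem' (x := t'A - t'P) hκ hτ.1 hτ.2
  have hD := mul_mul_le_max_of_mem' (x := UA - UP) hκ hd.1 hd.2
  have hWT := neg_abs_mul_norm_le_mul_re_expect' ω (t'A - t'P)
    (∑ k ∈ s, ((hubbardTTPrimeFermionInteraction 0 1 0).localHamiltonian Λ' * fermionEmbed (PolySite.incl hΛ) (B k) -
            fermionEmbed (PolySite.incl hΛ) (B k) * (hubbardTTPrimeFermionInteraction 0 1 0).localHamiltonian Λ') +
          ∑ r ∈ rr, ((lam r : ℝ) : ℂ) • (((β : ℝ) : ℂ) • ((fermionEmbed (PolySite.incl hΛ) (A r))ᴴ *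
            ((hubbardTTPrimeFermionInteraction 0 1 0).localHamiltonian Λ' * fermionEmbed (PolySite.incl hΛ) (A r) -
              fermionEmbed (PolySite.incl hΛ) (A r) * (hubbardTTPrimeFermionInteraction 0 1 0).localHamiltonian Λ'))) +
          ∑ e ∈ gg, ((kap e : ℝ) : ℂ) • GT e)
  have hWD := neg_abs_mul_norm_le_mul_re_expect' ω (UA - UP)
    (∑ k ∈ s, ((hubbardTTPrimeFermionInteraction 0 0 1).localHamiltonian Λ' * fermionEmbed (PolySite.incl hΛ) (B k) -
            fermionEmbed (PolySite.incl hΛ) (B k) * (hubbardTTPrimeFermionInteraction 0 0 1).localHamiltonian Λ') +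
          ∑ r ∈ rr, ((lam r : ℝ) : ℂ) • (((β : ℝ) : ℂ) • ((fermionEmbed (PolySite.incl hΛ) (A r))ᴴ *
            ((hubbardTTPrimeFermionInteraction 0 0 1).localHamiltonian Λ' * fermionEmbed (PolySite.incl hΛ) (A r) -
              fermionEmbed (PolySite.incl hΛ) (A r) * (hubbardTTPrimeFermionInteraction 0 0 1).localHamiltonian Λ'))) +
          ∑ e ∈ gg, ((kap e : ℝ) : ℂ) • GD e)
  rw [map_add, map_add, Complex.add_re, Complex.add_re] at hWT hWD
  have hcap : κ * (u - u') ≤ κ * (u - ω.meanEnergy (hubbardTTPrimeFermionInteraction t t'P UP) 1) :=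
    mul_le_mul_of_nonneg_left (by linarith) hκ
  linarith

/-! ### §4 The a-priori (kinematic) Lipschitz form for the thermal object -/

open scoped Matrix.Norms.L2Operator in
/-- **Kinematic Lipschitz form in `(t', U)` at `T = 1/β > 0`.** Under the hypotheses of `…_transport` with
`κ ≥ 0`, `U_P ≥ 0`, `0 ≤ n < 2`, `β > 0`, the tree's kinematic rows of thermal torus limits —
`|K₂(ω)| ≤ 16/π²` (`IsTorusLimitOfMixture.abs_meanEnergy_diagHop_le_of_sectorGibbs`),
`D(ω) ∈ [max(0,n−1), n/2] ⊆ [0, n/2]` (`…docc_mem_Icc_of_sectorGibbs`) and the entropy cap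
`e^{t t'_P U_P}(ω) ≤ energyDensityTT' t t'_P U_P n + 2H_b(n/2)/β`
(`…meanEnergy_hubbardTTPrime_le_energyDensityTT'_add_binEntropy_div`) — give
`c + κ(u − energyDensityTT' t t'_P U_P n − 2H_b(n/2)/β) − Σₖ ‖aₖ‖ + (Σ_σ μ_σ)(n/2 − ν)
   − |t'_A − t'_P|·(16κ/π² + ‖W_{t'} + V_{t'} + X_{t'}‖) − |U_A − U_P|·(κ n/2 + ‖W_U + V_U + X_U‖) ≤ Re ω_{Λ'}(Xw)`:
the certified thermal word of the anchor is Lipschitz in the couplings with these explicit constants. (The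
sharper sign-split `U`-leg — moving UP in `U` the docc term is a GAIN `|U_A−U_P| κ max(0,n−1) ≥ 0` — is
§3 with the same brackets.) [cite: FawziFawziScalet2024, Thm. 3.6] [cite: LiebLoss1993, §8, Theorem 8.2] -/
theorem IsTorusLimitOfMixture.re_expect_ge_of_thermal_certificate_symm_TT'_transport_kinematic
    (t t'A UA t'P UP : ℝ) {n : ℝ} (hn0 : 0 ≤ n) (hn2 : n < 2) {β : ℝ} (hβ : 0 < β) (hUP : 0 ≤ UP)
    {ω : InfVolFermionState 2} {Ls : ℕ → ℕ}
    (h : ω.IsTorusLimitOfMixture (sectorGibbsCount n) (fun L => sectorGibbsWeightTT' β t t'P UP n L)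
      (fun L => sectorGibbsVectorTT' t t'P UP n L) Ls)
    (hLs : Tendsto Ls atTop atTop)
    {Λ Λ' : Finset (Site 2)} (hΛ : Λ ⊆ Λ') (h8 : thicken Λ 1 ⊆ Λ')
    (h0 : thicken ({0} : Finset (Site 2)) 1 ⊆ Λ') (hz : (0 : Site 2) ∈ Λ')
    (Xw : FermionOp Λ') (κ u : ℝ) (μ : Fin 2 → ℝ) (ν : ℝ)
    {m : Type*} [Fintype m] [DecidableEq m] {Λm : Matrix m m ℂ} (hΛm : Λm.PosSemidef)
    (O : m → FermionOp Λ')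
    {κ' : Type*} (s : Finset κ') (B : κ' → FermionOp Λ)
    {ι : Type*} (tt : Finset ι) (γ : ι → DihedralGroup 4) (wv : ι → Site 2)
    (hsh : ∀ l, d4ShiftSet (γ l) (wv l) Λ ⊆ Λ') (Y : ι → FermionOp Λ)
    {ρ : Type*} (uu : Finset ρ) (b : ρ → ℂ) (cw : ρ → List (Orb (PolySite Λ') × Bool))
    (hcw : ∀ j ∈ uu, ladderCharge (cw j) ≠ 0 ∨ ladderSpinCharge (cw j) ≠ 0)
    {φ : Type*} (ff : Finset φ) (Yf : φ → FermionOp Λ')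
    {ζ : Type*} (zz : Finset ζ) (Nz : ζ → FermionOp Λ') (hnull : ∀ z ∈ zz, ω.expect Λ' (Nz z) = 0)
    {θ : Type*} (rr : Finset θ) (lam : θ → ℝ) (hlam : ∀ r ∈ rr, 0 ≤ lam r) (A : θ → FermionOp Λ)
    (hAN : ∀ r ∈ rr, Commute (A r) (totalNumber : FermionOp Λ))
    (hAS : ∀ r ∈ rr, Commute (A r) (HubbardWave0.spinZ : FermionOp Λ))
    (sv qv : θ → ℝ) (hq : ∀ r ∈ rr, Real.exp (sv r - 1) ≤ qv r)
    {η : Type*} (gg : Finset η) (kap : η → ℝ) (hkap : ∀ e ∈ gg, 0 ≤ kap e) (G GP GT GD : η → FermionOp Λ')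
    (hGsplit : ∀ e ∈ gg, G e = GP e + ((t'A - t'P : ℝ) : ℂ) • GT e + ((UA - UP : ℝ) : ℂ) • GD e)
    (hGP : ∀ e ∈ gg, 0 ≤ (ω.expect Λ' (GP e)).re)
    {δ : Type*} (ah : Finset δ) (dc : δ → ℝ) (V : δ → FermionOp Λ')
    {κ'' : Type*} (w : Finset κ'') (a : κ'' → ℂ) (word : κ'' → List (Orb (PolySite Λ') × Bool)) {c : ℝ}
    (hcert : Xw - (c : ℂ) • (1 : FermionOp Λ') -
        ∑ σ : Fin 2, ((μ σ : ℝ) : ℂ) • (nAt 0 hz σ - ((ν : ℝ) : ℂ) • (1 : FermionOp Λ')) -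
        ((κ : ℝ) : ℂ) • (((u : ℝ) : ℂ) • (1 : FermionOp Λ') -
          fermionEmbed (PolySite.incl h0) ((hubbardTTPrimeFermionInteraction t t'A UA).meanEnergyObs 1)) =
      gramForm Λm O +
        (∑ k ∈ s, ((hubbardTTPrimeFermionInteraction t t'A UA).localHamiltonian Λ' * fermionEmbed (PolySite.incl hΛ) (B k) -
            fermionEmbed (PolySite.incl hΛ) (B k) * (hubbardTTPrimeFermionInteraction t t'A UA).localHamiltonian Λ') +
          ∑ l ∈ tt, (fermionEmbed (PolySite.incl (hsh l)) (fermionEmbed (PolySite.d4Emb (γ l) (wv l) Λ) (Y l)) -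
            fermionEmbed (PolySite.incl hΛ) (Y l)) +
          ∑ j ∈ uu, b j • ladderWord (cw j) +
          ∑ f ∈ ff, (relabel (Orb.spinSwap : Orb (PolySite Λ') ≃ Orb (PolySite Λ')) (Yf f) - Yf f) +
          ∑ z ∈ zz, Nz z) +
        (∑ r ∈ rr, ((lam r : ℝ) : ℂ) •
            (((β : ℝ) : ℂ) • ((fermionEmbed (PolySite.incl hΛ) (A r))ᴴ *
                ((hubbardTTPrimeFermionInteraction t t'A UA).localHamiltonian Λ' * fermionEmbed (PolySite.incl hΛ) (A r) -
                  fermionEmbed (PolySite.incl hΛ) (A r) * (hubbardTTPrimeFermionInteraction t t'A UA).localHamiltonian Λ')) -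
              ((sv r : ℝ) : ℂ) • ((fermionEmbed (PolySite.incl hΛ) (A r))ᴴ * fermionEmbed (PolySite.incl hΛ) (A r)) +
              ((qv r : ℝ) : ℂ) • (fermionEmbed (PolySite.incl hΛ) (A r) * (fermionEmbed (PolySite.incl hΛ) (A r))ᴴ)) +
          ∑ e ∈ gg, ((kap e : ℝ) : ℂ) • G e) +
        (∑ m' ∈ ah, ((dc m' : ℝ) : ℂ) • ((V m')ᴴ - V m') + ∑ k ∈ w, a k • ladderWord (word k)))
    (hκ : 0 ≤ κ) :
    c + κ * (u - energyDensityTT' t t'P UP n - 2 * Real.binEntropy (n / 2) / β) - ∑ k ∈ w, ‖a k‖ +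
        (∑ σ : Fin 2, μ σ) * (n / 2 - ν) -
        |t'A - t'P| * (κ * (16 / Real.pi ^ 2) + ‖(∑ k ∈ s, ((hubbardTTPrimeFermionInteraction 0 1 0).localHamiltonian Λ' * fermionEmbed (PolySite.incl hΛ) (B k) -
            fermionEmbed (PolySite.incl hΛ) (B k) * (hubbardTTPrimeFermionInteraction 0 1 0).localHamiltonian Λ') +
          ∑ r ∈ rr, ((lam r : ℝ) : ℂ) • (((β : ℝ) : ℂ) • ((fermionEmbed (PolySite.incl hΛ) (A r))ᴴ *
            ((hubbardTTPrimeFermionInteraction 0 1 0).localHamiltonian Λ' * fermionEmbed (PolySite.incl hΛ) (A r) -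
              fermionEmbed (PolySite.incl hΛ) (A r) * (hubbardTTPrimeFermionInteraction 0 1 0).localHamiltonian Λ'))) +
          ∑ e ∈ gg, ((kap e : ℝ) : ℂ) • GT e)‖) -
        |UA - UP| * (κ * (n / 2) + ‖(∑ k ∈ s, ((hubbardTTPrimeFermionInteraction 0 0 1).localHamiltonian Λ' * fermionEmbed (PolySite.incl hΛ) (B k) -
            fermionEmbed (PolySite.incl hΛ) (B k) * (hubbardTTPrimeFermionInteraction 0 0 1).localHamiltonian Λ') +
          ∑ r ∈ rr, ((lam r : ℝ) : ℂ) • (((β : ℝ) : ℂ) • ((fermionEmbed (PolySite.incl hΛ) (A r))ᴴ *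
            ((hubbardTTPrimeFermionInteraction 0 0 1).localHamiltonian Λ' * fermionEmbed (PolySite.incl hΛ) (A r) -
              fermionEmbed (PolySite.incl hΛ) (A r) * (hubbardTTPrimeFermionInteraction 0 0 1).localHamiltonian Λ'))) +
          ∑ e ∈ gg, ((kap e : ℝ) : ℂ) • GD e)‖) ≤
      (ω.expect Λ' Xw).re := by
  have hK := abs_le.1 (h.abs_meanEnergy_diagHop_le_of_sectorGibbs t t'P UP hn0 hn2 β hLs)
  have hdI := h.docc_mem_Icc_of_sectorGibbs t t'P UP hn0 hn2.le β hLs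
  have hd0 : 0 ≤ ω.meanEnergy (hubbardTTPrimeFermionInteraction 0 0 1) 1 := le_trans (le_max_left _ _) hdI.1
  have hcapP := h.meanEnergy_hubbardTTPrime_le_energyDensityTT'_add_binEntropy_div t t'P hUP hn0 hn2 hβ hLs
  have hm := h.re_expect_ge_of_thermal_certificate_symm_TT'_transport_priced t t'A UA t'P UP hn0 hn2.le β hLs hΛ h8 h0 hz Xw κ u μ ν hΛm O s B tt γ wv
    hsh Y uu b cw hcw ff Yf zz Nz hnull rr lam hlam A hAN hAS sv qv hq gg kap hkap G GP GT GD hGsplit hGP ah dc V w a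
    word hcert hκ hcapP ⟨hK.1, hK.2⟩ ⟨hd0, hdI.2⟩
  -- the two `max` terms are bounded by the symmetric Lipschitz constants
  have hT : max ((t'A - t'P) * κ * (-(16 / Real.pi ^ 2))) ((t'A - t'P) * κ * (16 / Real.pi ^ 2)) ≤
      |t'A - t'P| * (κ * (16 / Real.pi ^ 2)) := by
    have hc : 0 ≤ κ * (16 / Real.pi ^ 2) := mul_nonneg hκ (by positivity)
    refine max_le ?_ ?_
    · have : (t'A - t'P) * κ * (-(16 / Real.pi ^ 2)) = (-(t'A - t'P)) * (κ * (16 / Real.pi ^ 2)) := by ring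
      rw [this]
      exact mul_le_mul_of_nonneg_right (neg_le_abs _) hc
    · rw [mul_assoc]
      exact mul_le_mul_of_nonneg_right (le_abs_self _) hc
  have hD : max ((UA - UP) * κ * 0) ((UA - UP) * κ * (n / 2)) ≤ |UA - UP| * (κ * (n / 2)) := by
    have hc : 0 ≤ κ * (n / 2) := mul_nonneg hκ (by linarith)
    refine max_le ?_ ?_
    · rw [mul_zero]
      exact mul_nonneg (abs_nonneg _) hc
    · rw [mul_assoc]
      exact mul_le_mul_of_nonneg_right (le_abs_self _) hc
  linarith [hT, hD, hm, norm_nonneg (∑ k ∈ s, ((hubbardTTPrimeFermionInteraction 0 1 0).localHamiltonian Λ' * fermionEmbed (PolySite.incl hΛ) (B k) -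
            fermionEmbed (PolySite.incl hΛ) (B k) * (hubbardTTPrimeFermionInteraction 0 1 0).localHamiltonian Λ') +
          ∑ r ∈ rr, ((lam r : ℝ) : ℂ) • (((β : ℝ) : ℂ) • ((fermionEmbed (PolySite.incl hΛ) (A r))ᴴ *
            ((hubbardTTPrimeFermionInteraction 0 1 0).localHamiltonian Λ' * fermionEmbed (PolySite.incl hΛ) (A r) -
              fermionEmbed (PolySite.incl hΛ) (A r) * (hubbardTTPrimeFermionInteraction 0 1 0).localHamiltonian Λ'))) +
          ∑ e ∈ gg, ((kap e : ℝ) : ℂ) • GT e),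
    norm_nonneg (∑ k ∈ s, ((hubbardTTPrimeFermionInteraction 0 0 1).localHamiltonian Λ' * fermionEmbed (PolySite.incl hΛ) (B k) -
            fermionEmbed (PolySite.incl hΛ) (B k) * (hubbardTTPrimeFermionInteraction 0 0 1).localHamiltonian Λ') +
          ∑ r ∈ rr, ((lam r : ℝ) : ℂ) • (((β : ℝ) : ℂ) • ((fermionEmbed (PolySite.incl hΛ) (A r))ᴴ *
            ((hubbardTTPrimeFermionInteraction 0 0 1).localHamiltonian Λ' * fermionEmbed (PolySite.incl hΛ) (A r) -
              fermionEmbed (PolySite.incl hΛ) (A r) * (hubbardTTPrimeFermionInteraction 0 0 1).localHamiltonian Λ'))) +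
          ∑ e ∈ gg, ((kap e : ℝ) : ℂ) • GD e), abs_nonneg (t'A - t'P), abs_nonneg (UA - UP)]


/-! ### §5 The `U`-ray (`t'_A = t'_P`): one thermal certificate at `U_A` words a `U`-interval at fixed `t'` -/

open scoped Matrix.Norms.L2Operator in
/-- **`U`-ray, priced.** The specialisation `t'_A = t'_P = t'` of `…_transport_priced`: a thermal certificate at
`(t, t', U_A)` read in a thermal torus limit `ω` at `(t, t', U_P)` (same `β`, extra rows split as
`Gₑ = G^P_ₑ + (U_A − U_P) G^D_ₑ`), with `κ ≥ 0`, a target cap `e^{t t' U_P}(ω) ≤ u'` and a docc bracket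
`D(ω) ∈ [dlo, dhi]` (on a `U`-box: the ENDPOINT thermal docc words,
`IsTorusLimitOfMixture.meanEnergy_onSite_mem_Icc_of_forall_endpoints_U_of_sectorGibbs`), gives
`c + κ(u − u') − Σₖ ‖aₖ‖ + (Σ_σ μ_σ)(n/2 − ν) − max((U_A−U_P)κ dlo, (U_A−U_P)κ dhi) − |U_A − U_P| ‖W_U + V_U + X_U‖
   ≤ Re ω_{Λ'}(Xw)` — the `T > 0` twin of `IsTorusLimitOf.re_expect_ge_of_window_certificate_TT'_ineq_transport_U`.
[cite: FawziFawziScalet2024, Thm. 3.6] [cite: KomaTasaki1994, §1] -/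
theorem IsTorusLimitOfMixture.re_expect_ge_of_thermal_certificate_symm_TT'_transport_U_priced
    (t t' UA UP : ℝ) {n : ℝ} (hn0 : 0 ≤ n) (hn2 : n ≤ 2) (β : ℝ)
    {ω : InfVolFermionState 2} {Ls : ℕ → ℕ}
    (h : ω.IsTorusLimitOfMixture (sectorGibbsCount n) (fun L => sectorGibbsWeightTT' β t t' UP n L)
      (fun L => sectorGibbsVectorTT' t t' UP n L) Ls)
    (hLs : Tendsto Ls atTop atTop)
    {Λ Λ' : Finset (Site 2)} (hΛ : Λ ⊆ Λ') (h8 : thicken Λ 1 ⊆ Λ')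
    (h0 : thicken ({0} : Finset (Site 2)) 1 ⊆ Λ') (hz : (0 : Site 2) ∈ Λ')
    (Xw : FermionOp Λ') (κ u : ℝ) (μ : Fin 2 → ℝ) (ν : ℝ)
    {m : Type*} [Fintype m] [DecidableEq m] {Λm : Matrix m m ℂ} (hΛm : Λm.PosSemidef)
    (O : m → FermionOp Λ')
    {κ' : Type*} (s : Finset κ') (B : κ' → FermionOp Λ)
    {ι : Type*} (tt : Finset ι) (γ : ι → DihedralGroup 4) (wv : ι → Site 2)
    (hsh : ∀ l, d4ShiftSet (γ l) (wv l) Λ ⊆ Λ') (Y : ι → FermionOp Λ)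
    {ρ : Type*} (uu : Finset ρ) (b : ρ → ℂ) (cw : ρ → List (Orb (PolySite Λ') × Bool))
    (hcw : ∀ j ∈ uu, ladderCharge (cw j) ≠ 0 ∨ ladderSpinCharge (cw j) ≠ 0)
    {φ : Type*} (ff : Finset φ) (Yf : φ → FermionOp Λ')
    {ζ : Type*} (zz : Finset ζ) (Nz : ζ → FermionOp Λ') (hnull : ∀ z ∈ zz, ω.expect Λ' (Nz z) = 0)
    {θ : Type*} (rr : Finset θ) (lam : θ → ℝ) (hlam : ∀ r ∈ rr, 0 ≤ lam r) (A : θ → FermionOp Λ)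
    (hAN : ∀ r ∈ rr, Commute (A r) (totalNumber : FermionOp Λ))
    (hAS : ∀ r ∈ rr, Commute (A r) (HubbardWave0.spinZ : FermionOp Λ))
    (sv qv : θ → ℝ) (hq : ∀ r ∈ rr, Real.exp (sv r - 1) ≤ qv r)
    {η : Type*} (gg : Finset η) (kap : η → ℝ) (hkap : ∀ e ∈ gg, 0 ≤ kap e) (G GP GD : η → FermionOp Λ')
    (hGsplit : ∀ e ∈ gg, G e = GP e + ((UA - UP : ℝ) : ℂ) • GD e)
    (hGP : ∀ e ∈ gg, 0 ≤ (ω.expect Λ' (GP e)).re)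
    {δ : Type*} (ah : Finset δ) (dc : δ → ℝ) (V : δ → FermionOp Λ')
    {κ'' : Type*} (w : Finset κ'') (a : κ'' → ℂ) (word : κ'' → List (Orb (PolySite Λ') × Bool)) {c : ℝ}
    (hcert : Xw - (c : ℂ) • (1 : FermionOp Λ') -
        ∑ σ : Fin 2, ((μ σ : ℝ) : ℂ) • (nAt 0 hz σ - ((ν : ℝ) : ℂ) • (1 : FermionOp Λ')) -
        ((κ : ℝ) : ℂ) • (((u : ℝ) : ℂ) • (1 : FermionOp Λ') -
          fermionEmbed (PolySite.incl h0) ((hubbardTTPrimeFermionInteraction t t' UA).meanEnergyObs 1)) =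
      gramForm Λm O +
        (∑ k ∈ s, ((hubbardTTPrimeFermionInteraction t t' UA).localHamiltonian Λ' * fermionEmbed (PolySite.incl hΛ) (B k) -
            fermionEmbed (PolySite.incl hΛ) (B k) * (hubbardTTPrimeFermionInteraction t t' UA).localHamiltonian Λ') +
          ∑ l ∈ tt, (fermionEmbed (PolySite.incl (hsh l)) (fermionEmbed (PolySite.d4Emb (γ l) (wv l) Λ) (Y l)) -
            fermionEmbed (PolySite.incl hΛ) (Y l)) +
          ∑ j ∈ uu, b j • ladderWord (cw j) +
          ∑ f ∈ ff, (relabel (Orb.spinSwap : Orb (PolySite Λ') ≃ Orb (PolySite Λ')) (Yf f) - Yf f) +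
          ∑ z ∈ zz, Nz z) +
        (∑ r ∈ rr, ((lam r : ℝ) : ℂ) •
            (((β : ℝ) : ℂ) • ((fermionEmbed (PolySite.incl hΛ) (A r))ᴴ *
                ((hubbardTTPrimeFermionInteraction t t' UA).localHamiltonian Λ' * fermionEmbed (PolySite.incl hΛ) (A r) -
                  fermionEmbed (PolySite.incl hΛ) (A r) * (hubbardTTPrimeFermionInteraction t t' UA).localHamiltonian Λ')) -
              ((sv r : ℝ) : ℂ) • ((fermionEmbed (PolySite.incl hΛ) (A r))ᴴ * fermionEmbed (PolySite.incl hΛ) (A r)) +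
              ((qv r : ℝ) : ℂ) • (fermionEmbed (PolySite.incl hΛ) (A r) * (fermionEmbed (PolySite.incl hΛ) (A r))ᴴ)) +
          ∑ e ∈ gg, ((kap e : ℝ) : ℂ) • G e) +
        (∑ m' ∈ ah, ((dc m' : ℝ) : ℂ) • ((V m')ᴴ - V m') + ∑ k ∈ w, a k • ladderWord (word k)))
    {u' : ℝ} (hκ : 0 ≤ κ) (hu' : ω.meanEnergy (hubbardTTPrimeFermionInteraction t t' UP) 1 ≤ u')
    {dlo dhi : ℝ}
    (hd : dlo ≤ ω.meanEnergy (hubbardTTPrimeFermionInteraction 0 0 1) 1 ∧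
      ω.meanEnergy (hubbardTTPrimeFermionInteraction 0 0 1) 1 ≤ dhi) :
    c + κ * (u - u') - ∑ k ∈ w, ‖a k‖ + (∑ σ : Fin 2, μ σ) * (n / 2 - ν) -
        max ((UA - UP) * κ * dlo) ((UA - UP) * κ * dhi) -
        |UA - UP| * ‖(∑ k ∈ s, ((hubbardTTPrimeFermionInteraction 0 0 1).localHamiltonian Λ' * fermionEmbed (PolySite.incl hΛ) (B k) -
            fermionEmbed (PolySite.incl hΛ) (B k) * (hubbardTTPrimeFermionInteraction 0 0 1).localHamiltonian Λ') +
          ∑ r ∈ rr, ((lam r : ℝ) : ℂ) • (((β : ℝ) : ℂ) • ((fermionEmbed (PolySite.incl hΛ) (A r))ᴴ *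
            ((hubbardTTPrimeFermionInteraction 0 0 1).localHamiltonian Λ' * fermionEmbed (PolySite.incl hΛ) (A r) -
              fermionEmbed (PolySite.incl hΛ) (A r) * (hubbardTTPrimeFermionInteraction 0 0 1).localHamiltonian Λ'))) +
          ∑ e ∈ gg, ((kap e : ℝ) : ℂ) • GD e)‖ ≤
      (ω.expect Λ' Xw).re := by
  have hsplit' : ∀ e ∈ gg, G e = GP e + ((t' - t' : ℝ) : ℂ) • (fun _ : η => (0 : FermionOp Λ')) e +
      ((UA - UP : ℝ) : ℂ) • GD e := fun e he => by
    rw [hGsplit e he, smul_zero, add_zero]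
  have hm := h.re_expect_ge_of_thermal_certificate_symm_TT'_transport_priced t t' UA t' UP hn0 hn2 β hLs hΛ h8 h0 hz Xw κ u μ ν hΛm O s B
    tt γ wv hsh Y uu b cw hcw ff Yf zz Nz hnull rr lam hlam A hAN hAS sv qv hq gg kap hkap G GP (fun _ => 0) GD hsplit' hGP
    ah dc V w a word hcert hκ hu' (τlo := ω.meanEnergy (hubbardTTPrimeFermionInteraction 0 1 0) 1)
    (τhi := ω.meanEnergy (hubbardTTPrimeFermionInteraction 0 1 0) 1) ⟨le_rfl, le_rfl⟩ hd
  simp only [sub_self, zero_mul, abs_zero, max_self, sub_zero] at hm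
  exact hm

open scoped Matrix.Norms.L2Operator in
/-- **`U`-ray, kinematic.** With `κ ≥ 0`, `U_P ≥ 0`, `0 ≤ n < 2`, `β > 0`:
`c + κ(u − energyDensityTT' t t' U_P n − 2H_b(n/2)/β) − Σₖ ‖aₖ‖ + (Σ_σ μ_σ)(n/2 − ν)
   − |U_A − U_P|·(κ n/2 + ‖W_U + V_U + X_U‖) ≤ Re ω_{Λ'}(Xw)` for every thermal torus limit `ω` at
`(β, t, t', U_P, n)`: the certified thermal word of the anchor `U_A` is Lipschitz along the `U`-ray.
[cite: FawziFawziScalet2024, Thm. 3.6] [cite: Ruelle1969, §3.4] -/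
theorem IsTorusLimitOfMixture.re_expect_ge_of_thermal_certificate_symm_TT'_transport_U_kinematic
    (t t' UA UP : ℝ) {n : ℝ} (hn0 : 0 ≤ n) (hn2 : n < 2) {β : ℝ} (hβ : 0 < β) (hUP : 0 ≤ UP)
    {ω : InfVolFermionState 2} {Ls : ℕ → ℕ}
    (h : ω.IsTorusLimitOfMixture (sectorGibbsCount n) (fun L => sectorGibbsWeightTT' β t t' UP n L)
      (fun L => sectorGibbsVectorTT' t t' UP n L) Ls)
    (hLs : Tendsto Ls atTop atTop)
    {Λ Λ' : Finset (Site 2)} (hΛ : Λ ⊆ Λ') (h8 : thicken Λ 1 ⊆ Λ')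
    (h0 : thicken ({0} : Finset (Site 2)) 1 ⊆ Λ') (hz : (0 : Site 2) ∈ Λ')
    (Xw : FermionOp Λ') (κ u : ℝ) (μ : Fin 2 → ℝ) (ν : ℝ)
    {m : Type*} [Fintype m] [DecidableEq m] {Λm : Matrix m m ℂ} (hΛm : Λm.PosSemidef)
    (O : m → FermionOp Λ')
    {κ' : Type*} (s : Finset κ') (B : κ' → FermionOp Λ)
    {ι : Type*} (tt : Finset ι) (γ : ι → DihedralGroup 4) (wv : ι → Site 2)
    (hsh : ∀ l, d4ShiftSet (γ l) (wv l) Λ ⊆ Λ') (Y : ι → FermionOp Λ)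
    {ρ : Type*} (uu : Finset ρ) (b : ρ → ℂ) (cw : ρ → List (Orb (PolySite Λ') × Bool))
    (hcw : ∀ j ∈ uu, ladderCharge (cw j) ≠ 0 ∨ ladderSpinCharge (cw j) ≠ 0)
    {φ : Type*} (ff : Finset φ) (Yf : φ → FermionOp Λ')
    {ζ : Type*} (zz : Finset ζ) (Nz : ζ → FermionOp Λ') (hnull : ∀ z ∈ zz, ω.expect Λ' (Nz z) = 0)
    {θ : Type*} (rr : Finset θ) (lam : θ → ℝ) (hlam : ∀ r ∈ rr, 0 ≤ lam r) (A : θ → FermionOp Λ)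
    (hAN : ∀ r ∈ rr, Commute (A r) (totalNumber : FermionOp Λ))
    (hAS : ∀ r ∈ rr, Commute (A r) (HubbardWave0.spinZ : FermionOp Λ))
    (sv qv : θ → ℝ) (hq : ∀ r ∈ rr, Real.exp (sv r - 1) ≤ qv r)
    {η : Type*} (gg : Finset η) (kap : η → ℝ) (hkap : ∀ e ∈ gg, 0 ≤ kap e) (G GP GD : η → FermionOp Λ')
    (hGsplit : ∀ e ∈ gg, G e = GP e + ((UA - UP : ℝ) : ℂ) • GD e)
    (hGP : ∀ e ∈ gg, 0 ≤ (ω.expect Λ' (GP e)).re)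
    {δ : Type*} (ah : Finset δ) (dc : δ → ℝ) (V : δ → FermionOp Λ')
    {κ'' : Type*} (w : Finset κ'') (a : κ'' → ℂ) (word : κ'' → List (Orb (PolySite Λ') × Bool)) {c : ℝ}
    (hcert : Xw - (c : ℂ) • (1 : FermionOp Λ') -
        ∑ σ : Fin 2, ((μ σ : ℝ) : ℂ) • (nAt 0 hz σ - ((ν : ℝ) : ℂ) • (1 : FermionOp Λ')) -
        ((κ : ℝ) : ℂ) • (((u : ℝ) : ℂ) • (1 : FermionOp Λ') -
          fermionEmbed (PolySite.incl h0) ((hubbardTTPrimeFermionInteraction t t' UA).meanEnergyObs 1)) =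
      gramForm Λm O +
        (∑ k ∈ s, ((hubbardTTPrimeFermionInteraction t t' UA).localHamiltonian Λ' * fermionEmbed (PolySite.incl hΛ) (B k) -
            fermionEmbed (PolySite.incl hΛ) (B k) * (hubbardTTPrimeFermionInteraction t t' UA).localHamiltonian Λ') +
          ∑ l ∈ tt, (fermionEmbed (PolySite.incl (hsh l)) (fermionEmbed (PolySite.d4Emb (γ l) (wv l) Λ) (Y l)) -
            fermionEmbed (PolySite.incl hΛ) (Y l)) +
          ∑ j ∈ uu, b j • ladderWord (cw j) +
          ∑ f ∈ ff, (relabel (Orb.spinSwap : Orb (PolySite Λ') ≃ Orb (PolySite Λ')) (Yf f) - Yf f) +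
          ∑ z ∈ zz, Nz z) +
        (∑ r ∈ rr, ((lam r : ℝ) : ℂ) •
            (((β : ℝ) : ℂ) • ((fermionEmbed (PolySite.incl hΛ) (A r))ᴴ *
                ((hubbardTTPrimeFermionInteraction t t' UA).localHamiltonian Λ' * fermionEmbed (PolySite.incl hΛ) (A r) -
                  fermionEmbed (PolySite.incl hΛ) (A r) * (hubbardTTPrimeFermionInteraction t t' UA).localHamiltonian Λ')) -
              ((sv r : ℝ) : ℂ) • ((fermionEmbed (PolySite.incl hΛ) (A r))ᴴ * fermionEmbed (PolySite.incl hΛ) (A r)) +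
              ((qv r : ℝ) : ℂ) • (fermionEmbed (PolySite.incl hΛ) (A r) * (fermionEmbed (PolySite.incl hΛ) (A r))ᴴ)) +
          ∑ e ∈ gg, ((kap e : ℝ) : ℂ) • G e) +
        (∑ m' ∈ ah, ((dc m' : ℝ) : ℂ) • ((V m')ᴴ - V m') + ∑ k ∈ w, a k • ladderWord (word k)))
    (hκ : 0 ≤ κ) :
    c + κ * (u - energyDensityTT' t t' UP n - 2 * Real.binEntropy (n / 2) / β) - ∑ k ∈ w, ‖a k‖ +
        (∑ σ : Fin 2, μ σ) * (n / 2 - ν) -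
        |UA - UP| * (κ * (n / 2) + ‖(∑ k ∈ s, ((hubbardTTPrimeFermionInteraction 0 0 1).localHamiltonian Λ' * fermionEmbed (PolySite.incl hΛ) (B k) -
            fermionEmbed (PolySite.incl hΛ) (B k) * (hubbardTTPrimeFermionInteraction 0 0 1).localHamiltonian Λ') +
          ∑ r ∈ rr, ((lam r : ℝ) : ℂ) • (((β : ℝ) : ℂ) • ((fermionEmbed (PolySite.incl hΛ) (A r))ᴴ *
            ((hubbardTTPrimeFermionInteraction 0 0 1).localHamiltonian Λ' * fermionEmbed (PolySite.incl hΛ) (A r) -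
              fermionEmbed (PolySite.incl hΛ) (A r) * (hubbardTTPrimeFermionInteraction 0 0 1).localHamiltonian Λ'))) +
          ∑ e ∈ gg, ((kap e : ℝ) : ℂ) • GD e)‖) ≤
      (ω.expect Λ' Xw).re := by
  have hsplit' : ∀ e ∈ gg, G e = GP e + ((t' - t' : ℝ) : ℂ) • (fun _ : η => (0 : FermionOp Λ')) e +
      ((UA - UP : ℝ) : ℂ) • GD e := fun e he => by
    rw [hGsplit e he, smul_zero, add_zero]
  have hm := h.re_expect_ge_of_thermal_certificate_symm_TT'_transport_kinematic t t' UA t' UP hn0 hn2 hβ hUP hLs hΛ h8 h0 hz Xw κ u μ ν hΛm O s B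
    tt γ wv hsh Y uu b cw hcw ff Yf zz Nz hnull rr lam hlam A hAN hAS sv qv hq gg kap hkap G GP (fun _ => 0) GD hsplit' hGP
    ah dc V w a word hcert hκ
  simp only [sub_self, abs_zero, zero_mul, sub_zero] at hm
  exact hm


/-! ### §6 Cell form: constants uniform over a `(t', U)` rectangle around the anchor -/

open scoped Matrix.Norms.L2Operator in
/-- **Cell (rectangle) form of the kinematic transport.** Under the hypotheses of `…_transport_kinematic`, if
the target lies within `|t'_A − t'_P| ≤ Δs`, `|U_A − U_P| ≤ ΔU` of the anchor and `R` is any certified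
ground-state-energy CAP `energyDensityTT' t t'_P U_P n ≤ R` (e.g. a box energy-cap word of
`HubbardTTPrimeBoxWordCovering` / `HubbardTTPrimeBoxTransport`, uniform over the rectangle; the thermal energy
at the target is then `≤ R + 2H_b(n/2)/β`), then
`c + κ(u − R − 2H_b(n/2)/β) − Σₖ ‖aₖ‖ + (Σ_σ μ_σ)(n/2 − ν) − Δs·(16κ/π² + ‖C_{t'}‖) − ΔU·(κ n/2 + ‖C_U‖) ≤ Re ω_{Λ'}(Xw)`
— a right-hand side that no longer depends on the target point: ONE EEB-class thermal certificate at the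
anchor words EVERY thermal torus limit (same `β`) of the whole rectangle `[t'_A − Δs, t'_A + Δs] × [U_A − ΔU, U_A + ΔU]`
(`U ≥ 0`) by one constant, the shape the S2 cell seams consume. [cite: FawziFawziScalet2024, Thm. 3.6]
[cite: LiebLoss1993, §8, Theorem 8.2] -/
theorem IsTorusLimitOfMixture.re_expect_ge_of_thermal_certificate_symm_TT'_transport_cell
    (t t'A UA t'P UP : ℝ) {n : ℝ} (hn0 : 0 ≤ n) (hn2 : n < 2) {β : ℝ} (hβ : 0 < β) (hUP : 0 ≤ UP)
    {ω : InfVolFermionState 2} {Ls : ℕ → ℕ}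
    (h : ω.IsTorusLimitOfMixture (sectorGibbsCount n) (fun L => sectorGibbsWeightTT' β t t'P UP n L)
      (fun L => sectorGibbsVectorTT' t t'P UP n L) Ls)
    (hLs : Tendsto Ls atTop atTop)
    {Λ Λ' : Finset (Site 2)} (hΛ : Λ ⊆ Λ') (h8 : thicken Λ 1 ⊆ Λ')
    (h0 : thicken ({0} : Finset (Site 2)) 1 ⊆ Λ') (hz : (0 : Site 2) ∈ Λ')
    (Xw : FermionOp Λ') (κ u : ℝ) (μ : Fin 2 → ℝ) (ν : ℝ)
    {m : Type*} [Fintype m] [DecidableEq m] {Λm : Matrix m m ℂ} (hΛm : Λm.PosSemidef)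
    (O : m → FermionOp Λ')
    {κ' : Type*} (s : Finset κ') (B : κ' → FermionOp Λ)
    {ι : Type*} (tt : Finset ι) (γ : ι → DihedralGroup 4) (wv : ι → Site 2)
    (hsh : ∀ l, d4ShiftSet (γ l) (wv l) Λ ⊆ Λ') (Y : ι → FermionOp Λ)
    {ρ : Type*} (uu : Finset ρ) (b : ρ → ℂ) (cw : ρ → List (Orb (PolySite Λ') × Bool))
    (hcw : ∀ j ∈ uu, ladderCharge (cw j) ≠ 0 ∨ ladderSpinCharge (cw j) ≠ 0)
    {φ : Type*} (ff : Finset φ) (Yf : φ → FermionOp Λ')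
    {ζ : Type*} (zz : Finset ζ) (Nz : ζ → FermionOp Λ') (hnull : ∀ z ∈ zz, ω.expect Λ' (Nz z) = 0)
    {θ : Type*} (rr : Finset θ) (lam : θ → ℝ) (hlam : ∀ r ∈ rr, 0 ≤ lam r) (A : θ → FermionOp Λ)
    (hAN : ∀ r ∈ rr, Commute (A r) (totalNumber : FermionOp Λ))
    (hAS : ∀ r ∈ rr, Commute (A r) (HubbardWave0.spinZ : FermionOp Λ))
    (sv qv : θ → ℝ) (hq : ∀ r ∈ rr, Real.exp (sv r - 1) ≤ qv r)
    {η : Type*} (gg : Finset η) (kap : η → ℝ) (hkap : ∀ e ∈ gg, 0 ≤ kap e) (G GP GT GD : η → FermionOp Λ')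
    (hGsplit : ∀ e ∈ gg, G e = GP e + ((t'A - t'P : ℝ) : ℂ) • GT e + ((UA - UP : ℝ) : ℂ) • GD e)
    (hGP : ∀ e ∈ gg, 0 ≤ (ω.expect Λ' (GP e)).re)
    {δ : Type*} (ah : Finset δ) (dc : δ → ℝ) (V : δ → FermionOp Λ')
    {κ'' : Type*} (w : Finset κ'') (a : κ'' → ℂ) (word : κ'' → List (Orb (PolySite Λ') × Bool)) {c : ℝ}
    (hcert : Xw - (c : ℂ) • (1 : FermionOp Λ') -
        ∑ σ : Fin 2, ((μ σ : ℝ) : ℂ) • (nAt 0 hz σ - ((ν : ℝ) : ℂ) • (1 : FermionOp Λ')) -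
        ((κ : ℝ) : ℂ) • (((u : ℝ) : ℂ) • (1 : FermionOp Λ') -
          fermionEmbed (PolySite.incl h0) ((hubbardTTPrimeFermionInteraction t t'A UA).meanEnergyObs 1)) =
      gramForm Λm O +
        (∑ k ∈ s, ((hubbardTTPrimeFermionInteraction t t'A UA).localHamiltonian Λ' * fermionEmbed (PolySite.incl hΛ) (B k) -
            fermionEmbed (PolySite.incl hΛ) (B k) * (hubbardTTPrimeFermionInteraction t t'A UA).localHamiltonian Λ') +
          ∑ l ∈ tt, (fermionEmbed (PolySite.incl (hsh l)) (fermionEmbed (PolySite.d4Emb (γ l) (wv l) Λ) (Y l)) -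
            fermionEmbed (PolySite.incl hΛ) (Y l)) +
          ∑ j ∈ uu, b j • ladderWord (cw j) +
          ∑ f ∈ ff, (relabel (Orb.spinSwap : Orb (PolySite Λ') ≃ Orb (PolySite Λ')) (Yf f) - Yf f) +
          ∑ z ∈ zz, Nz z) +
        (∑ r ∈ rr, ((lam r : ℝ) : ℂ) •
            (((β : ℝ) : ℂ) • ((fermionEmbed (PolySite.incl hΛ) (A r))ᴴ *
                ((hubbardTTPrimeFermionInteraction t t'A UA).localHamiltonian Λ' * fermionEmbed (PolySite.incl hΛ) (A r) -
                  fermionEmbed (PolySite.incl hΛ) (A r) * (hubbardTTPrimeFermionInteraction t t'A UA).localHamiltonian Λ')) -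
              ((sv r : ℝ) : ℂ) • ((fermionEmbed (PolySite.incl hΛ) (A r))ᴴ * fermionEmbed (PolySite.incl hΛ) (A r)) +
              ((qv r : ℝ) : ℂ) • (fermionEmbed (PolySite.incl hΛ) (A r) * (fermionEmbed (PolySite.incl hΛ) (A r))ᴴ)) +
          ∑ e ∈ gg, ((kap e : ℝ) : ℂ) • G e) +
        (∑ m' ∈ ah, ((dc m' : ℝ) : ℂ) • ((V m')ᴴ - V m') + ∑ k ∈ w, a k • ladderWord (word k)))
    (hκ : 0 ≤ κ) {Δs ΔU R : ℝ} (hΔs : |t'A - t'P| ≤ Δs) (hΔU : |UA - UP| ≤ ΔU)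
    (hR : energyDensityTT' t t'P UP n ≤ R) :
    c + κ * (u - R - 2 * Real.binEntropy (n / 2) / β) - ∑ k ∈ w, ‖a k‖ +
        (∑ σ : Fin 2, μ σ) * (n / 2 - ν) -
        Δs * (κ * (16 / Real.pi ^ 2) + ‖(∑ k ∈ s, ((hubbardTTPrimeFermionInteraction 0 1 0).localHamiltonian Λ' * fermionEmbed (PolySite.incl hΛ) (B k) -
            fermionEmbed (PolySite.incl hΛ) (B k) * (hubbardTTPrimeFermionInteraction 0 1 0).localHamiltonian Λ') +
          ∑ r ∈ rr, ((lam r : ℝ) : ℂ) • (((β : ℝ) : ℂ) • ((fermionEmbed (PolySite.incl hΛ) (A r))ᴴ *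
            ((hubbardTTPrimeFermionInteraction 0 1 0).localHamiltonian Λ' * fermionEmbed (PolySite.incl hΛ) (A r) -
              fermionEmbed (PolySite.incl hΛ) (A r) * (hubbardTTPrimeFermionInteraction 0 1 0).localHamiltonian Λ'))) +
          ∑ e ∈ gg, ((kap e : ℝ) : ℂ) • GT e)‖) -
        ΔU * (κ * (n / 2) + ‖(∑ k ∈ s, ((hubbardTTPrimeFermionInteraction 0 0 1).localHamiltonian Λ' * fermionEmbed (PolySite.incl hΛ) (B k) -
            fermionEmbed (PolySite.incl hΛ) (B k) * (hubbardTTPrimeFermionInteraction 0 0 1).localHamiltonian Λ') +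
          ∑ r ∈ rr, ((lam r : ℝ) : ℂ) • (((β : ℝ) : ℂ) • ((fermionEmbed (PolySite.incl hΛ) (A r))ᴴ *
            ((hubbardTTPrimeFermionInteraction 0 0 1).localHamiltonian Λ' * fermionEmbed (PolySite.incl hΛ) (A r) -
              fermionEmbed (PolySite.incl hΛ) (A r) * (hubbardTTPrimeFermionInteraction 0 0 1).localHamiltonian Λ'))) +
          ∑ e ∈ gg, ((kap e : ℝ) : ℂ) • GD e)‖) ≤
      (ω.expect Λ' Xw).re := by
  have hm := h.re_expect_ge_of_thermal_certificate_symm_TT'_transport_kinematic t t'A UA t'P UP hn0 hn2 hβ hUP hLs hΛ h8 h0 hz Xw κ u μ ν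
    hΛm O s B tt γ wv hsh Y uu b cw hcw ff Yf zz Nz hnull rr lam hlam A hAN hAS sv qv hq gg kap hkap G GP GT GD hGsplit
    hGP ah dc V w a word hcert hκ
  have hcT : 0 ≤ κ * (16 / Real.pi ^ 2) + ‖(∑ k ∈ s, ((hubbardTTPrimeFermionInteraction 0 1 0).localHamiltonian Λ' * fermionEmbed (PolySite.incl hΛ) (B k) -
            fermionEmbed (PolySite.incl hΛ) (B k) * (hubbardTTPrimeFermionInteraction 0 1 0).localHamiltonian Λ') +
          ∑ r ∈ rr, ((lam r : ℝ) : ℂ) • (((β : ℝ) : ℂ) • ((fermionEmbed (PolySite.incl hΛ) (A r))ᴴ *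
            ((hubbardTTPrimeFermionInteraction 0 1 0).localHamiltonian Λ' * fermionEmbed (PolySite.incl hΛ) (A r) -
              fermionEmbed (PolySite.incl hΛ) (A r) * (hubbardTTPrimeFermionInteraction 0 1 0).localHamiltonian Λ'))) +
          ∑ e ∈ gg, ((kap e : ℝ) : ℂ) • GT e)‖ :=
    add_nonneg (mul_nonneg hκ (by positivity)) (norm_nonneg _)
  have hcD : 0 ≤ κ * (n / 2) + ‖(∑ k ∈ s, ((hubbardTTPrimeFermionInteraction 0 0 1).localHamiltonian Λ' * fermionEmbed (PolySite.incl hΛ) (B k) -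
            fermionEmbed (PolySite.incl hΛ) (B k) * (hubbardTTPrimeFermionInteraction 0 0 1).localHamiltonian Λ') +
          ∑ r ∈ rr, ((lam r : ℝ) : ℂ) • (((β : ℝ) : ℂ) • ((fermionEmbed (PolySite.incl hΛ) (A r))ᴴ *
            ((hubbardTTPrimeFermionInteraction 0 0 1).localHamiltonian Λ' * fermionEmbed (PolySite.incl hΛ) (A r) -
              fermionEmbed (PolySite.incl hΛ) (A r) * (hubbardTTPrimeFermionInteraction 0 0 1).localHamiltonian Λ'))) +
          ∑ e ∈ gg, ((kap e : ℝ) : ℂ) • GD e)‖ :=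
    add_nonneg (mul_nonneg hκ (by linarith)) (norm_nonneg _)
  have h1 := mul_le_mul_of_nonneg_right hΔs hcT
  have h2 := mul_le_mul_of_nonneg_right hΔU hcD
  have h3 : κ * (u - R - 2 * Real.binEntropy (n / 2) / β) ≤
      κ * (u - energyDensityTT' t t'P UP n - 2 * Real.binEntropy (n / 2) / β) :=
    mul_le_mul_of_nonneg_left (by linarith) hκ
  linarith


/-! ### §7 Readers for the transported thermal ENERGY window (objective `−Γ E^{t t'_A U_A}_Φ`) -/

/-- **Anchor-energy bound ⇒ target-energy cap.** For ANY state `ω` of the lattice fermions on `ℤ²`: a bound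
`lb ≤ Re ω_{Λ'}(−Γ E_{Φ(t,t'_A,U_A)})` on the ANCHOR mean-energy observable (e.g. the conclusion of
`…re_expect_ge_of_thermal_certificate_symm_TT'_transport` for a thermal energy-cap certificate, objective
`Xw = −Γ E_{Φ(t,t'_A,U_A)}`, `κ = 0`) is a cap on the TARGET mean energy,
`e_{Φ(t,t'_P,U_P)}(ω) ≤ −lb − (t'_A − t'_P) K₂(ω) − (U_A − U_P) D(ω)` — the mean energy is affine in the
couplings (`meanEnergy_hubbardTTPrime_affine`). [cite: BratteliKishimotoRobinson1978, §3] -/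
theorem meanEnergy_target_le_of_anchor_bound (ω : InfVolFermionState 2) (t t'A UA t'P UP : ℝ)
    {Λ' : Finset (Site 2)} (h0 : thicken ({0} : Finset (Site 2)) 1 ⊆ Λ') {lb : ℝ}
    (hlb : lb ≤ (ω.expect Λ'
      (-fermionEmbed (PolySite.incl h0) ((hubbardTTPrimeFermionInteraction t t'A UA).meanEnergyObs 1))).re) :
    ω.meanEnergy (hubbardTTPrimeFermionInteraction t t'P UP) 1 ≤
      -lb - (t'A - t'P) * ω.meanEnergy (hubbardTTPrimeFermionInteraction 0 1 0) 1 -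
        (UA - UP) * ω.meanEnergy (hubbardTTPrimeFermionInteraction 0 0 1) 1 := by
  rw [map_neg, Complex.neg_re, ω.re_expect_fermionEmbed_meanEnergyObs _ 1 h0,
    ω.meanEnergy_hubbardTTPrime_affine t t'P UP t'A UA] at hlb
  linarith

/-- **Kinematic form for the thermal object.** For `ω` a torus limit of the canonical sector Gibbs states at
`(β, t, t'_P, U_P, n)` (`0 ≤ n < 2`): `lb ≤ Re ω_{Λ'}(−Γ E_{Φ(t,t'_A,U_A)})` gives
`e_{Φ(t,t'_P,U_P)}(ω) ≤ −lb + |t'_A − t'_P|·16/π² + max(U_P − U_A, 0)·(n/2)` (`|K₂| ≤ 16/π²`,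
`0 ≤ D ≤ n/2`; moving DOWN in `U` the docc term is free). With the variational floor
`energyDensityTT' t t'_P U_P n ≤ e_{Φ(t,t'_P,U_P)}(ω)` (`…energyDensityTT'_le_meanEnergy_of_sectorGibbs`) this is
the two-sided thermal energy window at the target from ONE anchor cap certificate.
[cite: FawziFawziScalet2024, Thm. 3.6] [cite: LiebLoss1993, §8, Theorem 8.2] -/
theorem IsTorusLimitOfMixture.meanEnergy_target_le_kinematic_of_anchor_bound
    (t t'A UA t'P UP : ℝ) {n : ℝ} (hn0 : 0 ≤ n) (hn2 : n < 2) (β : ℝ)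
    {ω : InfVolFermionState 2} {Ls : ℕ → ℕ}
    (h : ω.IsTorusLimitOfMixture (sectorGibbsCount n) (fun L => sectorGibbsWeightTT' β t t'P UP n L)
      (fun L => sectorGibbsVectorTT' t t'P UP n L) Ls)
    (hLs : Tendsto Ls atTop atTop)
    {Λ' : Finset (Site 2)} (h0 : thicken ({0} : Finset (Site 2)) 1 ⊆ Λ') {lb : ℝ}
    (hlb : lb ≤ (ω.expect Λ'
      (-fermionEmbed (PolySite.incl h0) ((hubbardTTPrimeFermionInteraction t t'A UA).meanEnergyObs 1))).re) :
    ω.meanEnergy (hubbardTTPrimeFermionInteraction t t'P UP) 1 ≤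
      -lb + |t'A - t'P| * (16 / Real.pi ^ 2) + max (UP - UA) 0 * (n / 2) := by
  have h1 := ω.meanEnergy_target_le_of_anchor_bound t t'A UA t'P UP h0 hlb
  have hK := abs_le.1 (h.abs_meanEnergy_diagHop_le_of_sectorGibbs t t'P UP hn0 hn2 β hLs)
  have hdI := h.docc_mem_Icc_of_sectorGibbs t t'P UP hn0 hn2.le β hLs
  have hd0 : 0 ≤ ω.meanEnergy (hubbardTTPrimeFermionInteraction 0 0 1) 1 := le_trans (le_max_left _ _) hdI.1
  -- the `t'`-leg
  have hT : -((t'A - t'P) * ω.meanEnergy (hubbardTTPrimeFermionInteraction 0 1 0) 1) ≤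
      |t'A - t'P| * (16 / Real.pi ^ 2) := by
    have := abs_mul (t'A - t'P) (ω.meanEnergy (hubbardTTPrimeFermionInteraction 0 1 0) 1)
    have hb : |ω.meanEnergy (hubbardTTPrimeFermionInteraction 0 1 0) 1| ≤ 16 / Real.pi ^ 2 := abs_le.2 ⟨hK.1, hK.2⟩
    have hprod : |(t'A - t'P) * ω.meanEnergy (hubbardTTPrimeFermionInteraction 0 1 0) 1| ≤
        |t'A - t'P| * (16 / Real.pi ^ 2) := by
      rw [this]; exact mul_le_mul_of_nonneg_left hb (abs_nonneg _)
    exact (abs_le.1 hprod).1 |> fun h' => by linarith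
  -- the `U`-leg: `(U_P − U_A)·D ≤ max(U_P − U_A, 0)·(n/2)`
  have hU : -((UA - UP) * ω.meanEnergy (hubbardTTPrimeFermionInteraction 0 0 1) 1) ≤
      max (UP - UA) 0 * (n / 2) := by
    have e1 : -((UA - UP) * ω.meanEnergy (hubbardTTPrimeFermionInteraction 0 0 1) 1) =
        (UP - UA) * ω.meanEnergy (hubbardTTPrimeFermionInteraction 0 0 1) 1 := by ring
    rw [e1]
    calc (UP - UA) * ω.meanEnergy (hubbardTTPrimeFermionInteraction 0 0 1) 1
        ≤ max (UP - UA) 0 * ω.meanEnergy (hubbardTTPrimeFermionInteraction 0 0 1) 1 :=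
          mul_le_mul_of_nonneg_right (le_max_left _ _) hd0
      _ ≤ max (UP - UA) 0 * (n / 2) := mul_le_mul_of_nonneg_left hdI.2 (le_max_right _ _)
  linarith

end InfVolFermionState

end Literature.MathematicalPhysics.QuantumLattice

end
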